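import Summits.ResolutionOfSingularities.ResolutionOfSingularities.Theses.FrobeniusLadder
import Literature.AlgebraicGeometry.Resolution.QuasiProjectiveResolution
import Literature.AlgebraicGeometry.Resolution.ResolutionOfComponents
import Literature.AlgebraicGeometry.Resolution.PrincipalizationToResolution
import Literature.RingTheory.TightClosure.RegularTightlyClosed
import Literature.AlgebraicGeometry.Resolution.RegularLocalRingsQuotient
import Literature.RingTheory.TightClosure.FRationalNormal
import Summits.ResolutionOfSingularities.ResolutionOfSingularities.Theorems.FrobeniusLadderFRationalResolutionStubTransport
import Summits.ResolutionOfSingularities.ResolutionOfSingularities.Theorems.FrobeniusLadderFRationalResolutionStubClauseOfRingEquiv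
import Summits.ResolutionOfSingularities.ResolutionOfSingularities.Theorems.FrobeniusLadderFRationalResolutionStubComponents
import Summits.ResolutionOfSingularities.ResolutionOfSingularities.Theorems.FrobeniusLadderFRationalResolutionStubRungsOfSummit
import Summits.ResolutionOfSingularities.ResolutionOfSingularities.Theorems.FrobeniusLadderFRationalResolutionSuspensionCalibration
import Summits.ResolutionOfSingularities.ResolutionOfSingularities.Theorems.FrobeniusLadderFRationalResolutionConeProdResolution
import Summits.ResolutionOfSingularities.ResolutionOfSingularities.Theorems.FrobeniusLadderFRationalResolutionConeCubeResolution
import Summits.ResolutionOfSingularities.ResolutionOfSingularities.Theorems.FrobeniusLadderFRationalResolutionSuspensionSingularLocus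
import Summits.ResolutionOfSingularities.ResolutionOfSingularities.Theorems.FrobeniusLadderFRationalResolutionDoubleColonOfSocleCyclic
import Summits.ResolutionOfSingularities.ResolutionOfSingularities.Theorems.FrobeniusLadderFRationalResolutionColonTightlyClosed
import Summits.ResolutionOfSingularities.ResolutionOfSingularities.Theorems.FrobeniusLadderFRationalResolutionClauseOfMPrimary
import Summits.ResolutionOfSingularities.ResolutionOfSingularities.Theorems.FrobeniusLadderFRationalResolutionSopLeOfMPrimary
import Summits.ResolutionOfSingularities.ResolutionOfSingularities.Theorems.FrobeniusLadderFRationalResolutionSocleCyclicOfCI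
import Summits.ResolutionOfSingularities.ResolutionOfSingularities.Theorems.FrobeniusLadderFRationalResolutionHypersurfaceQuotientData
import Summits.ResolutionOfSingularities.ResolutionOfSingularities.Theorems.FrobeniusLadderFRationalResolutionSpecHypersurface
import Summits.ResolutionOfSingularities.ResolutionOfSingularities.Theorems.FrobeniusLadderFRationalResolutionFRationalCM
import Summits.ResolutionOfSingularities.ResolutionOfSingularities.Theorems.FrobeniusLadderFRationalResolutionSocleCyclicOfOne
import Summits.ResolutionOfSingularities.ResolutionOfSingularities.Theorems.FrobeniusLadderFRationalResolutionChartGraphPow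
import Summits.ResolutionOfSingularities.ResolutionOfSingularities.Theorems.FrobeniusLadderFRationalResolutionChartElimPow
import Summits.ResolutionOfSingularities.ResolutionOfSingularities.Theorems.FrobeniusLadderFRationalResolutionResolutionOpenGlue
import Summits.ResolutionOfSingularities.ResolutionOfSingularities.Theorems.FrobeniusLadderFRationalResolutionGorensteinForm
import Literature.RingTheory.TightClosure.TightClosure
import Summits.ResolutionOfSingularities.ResolutionOfSingularities.Theorems.FrobeniusLadderFRationalResolutionResolutionOpenGlue2
import Summits.ResolutionOfSingularities.ResolutionOfSingularities.Theorems.FrobeniusLadderFRationalResolutionTightClosurePowerStep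
import Summits.ResolutionOfSingularities.ResolutionOfSingularities.Theorems.FrobeniusLadderFRationalResolutionTightClosureExchange
import Summits.ResolutionOfSingularities.ResolutionOfSingularities.Theorems.FrobeniusLadderFRationalResolutionAffineSpaceRegular
import Summits.ResolutionOfSingularities.ResolutionOfSingularities.Theorems.FrobeniusLadderFRationalResolutionAffineSpaceBirational
import Summits.ResolutionOfSingularities.ResolutionOfSingularities.Theorems.FrobeniusLadderFRationalResolutionSuspensionPowAffineSpace
import Summits.ResolutionOfSingularities.ResolutionOfSingularities.Theorems.FrobeniusLadderFRationalResolutionFRationalOfOneSop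
import Summits.ResolutionOfSingularities.ResolutionOfSingularities.Theorems.FrobeniusLadderFRationalResolutionAffineSpaceResolution
import Summits.ResolutionOfSingularities.ResolutionOfSingularities.Theorems.FrobeniusLadderFRationalResolutionAnResolutionBase
import Summits.ResolutionOfSingularities.ResolutionOfSingularities.Theorems.FrobeniusLadderFRationalResolutionTowerStep
import Summits.ResolutionOfSingularities.ResolutionOfSingularities.Theorems.FrobeniusLadderFRationalResolutionResolutionLocal
import Summits.ResolutionOfSingularities.ResolutionOfSingularities.Theorems.FrobeniusLadderFRationalResolutionResolutionRestrict
import Summits.ResolutionOfSingularities.ResolutionOfSingularities.Theorems.FrobeniusLadderFRationalResolutionFRationalSurfaceLocal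
import Summits.ResolutionOfSingularities.ResolutionOfSingularities.Theorems.FrobeniusLadderFRationalResolutionOneSopQuotient
import Summits.ResolutionOfSingularities.ResolutionOfSingularities.Theorems.FrobeniusLadderFRationalResolutionAnResolutionStep
import Summits.ResolutionOfSingularities.ResolutionOfSingularities.Theorems.FrobeniusLadderFRationalResolutionSuspensionPowResolution
import Summits.ResolutionOfSingularities.ResolutionOfSingularities.Theorems.FrobeniusLadderFRationalResolutionFRationalSurfaceAnCharts
import Summits.ResolutionOfSingularities.ResolutionOfSingularities.Theorems.FrobeniusLadderFRationalResolutionSmoothBaseChange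
import Summits.ResolutionOfSingularities.ResolutionOfSingularities.Theorems.FrobeniusLadderFRationalResolutionStalkPresentationRegular
import Summits.ResolutionOfSingularities.ResolutionOfSingularities.Theorems.FrobeniusLadderFRationalResolutionHypersurfaceOneSop
import Summits.ResolutionOfSingularities.ResolutionOfSingularities.Theorems.FrobeniusLadderFRationalResolutionSpreadOutFinite
import Summits.ResolutionOfSingularities.ResolutionOfSingularities.Theorems.FrobeniusLadderFRationalResolutionModelOpenGlue
import Summits.ResolutionOfSingularities.ResolutionOfSingularities.Theorems.FrobeniusLadderFRationalResolutionDiagonalizableQuotientPerfect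
import Summits.ResolutionOfSingularities.ResolutionOfSingularities.Theorems.FrobeniusLadderFRationalResolutionOneSopStalk
import Summits.ResolutionOfSingularities.ResolutionOfSingularities.Theorems.FrobeniusLadderFRationalResolutionOneSopScheme
import Summits.ResolutionOfSingularities.ResolutionOfSingularities.Theorems.FrobeniusLadderFRationalResolutionModelLocal
import Summits.ResolutionOfSingularities.ResolutionOfSingularities.Theorems.FrobeniusLadderFRationalResolutionWeaklyFRegularModelLocal
import Summits.ResolutionOfSingularities.ResolutionOfSingularities.Theorems.FrobeniusLadderFRationalResolutionFRationalCMStalk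
import Summits.ResolutionOfSingularities.ResolutionOfSingularities.Theorems.FrobeniusLadderFRationalResolutionPrimeAdaptedParameters
import Summits.ResolutionOfSingularities.ResolutionOfSingularities.Theorems.FrobeniusLadderFRationalResolutionSopExtension
import Summits.ResolutionOfSingularities.ResolutionOfSingularities.Theorems.FrobeniusLadderFRationalResolutionMultiplierOffMinimalPrime
import Summits.ResolutionOfSingularities.ResolutionOfSingularities.Theorems.FrobeniusLadderFRationalResolutionAtPrimeQuotientPresentation
import Summits.ResolutionOfSingularities.ResolutionOfSingularities.Theorems.FrobeniusLadderFRationalResolutionFRationalLocalizesCore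
import Summits.ResolutionOfSingularities.ResolutionOfSingularities.Theorems.FrobeniusLadderFRationalResolutionFrobeniusPowerUnmixed
import Summits.ResolutionOfSingularities.ResolutionOfSingularities.Theorems.FrobeniusLadderFRationalResolutionFRationalLocalizes
import Summits.ResolutionOfSingularities.ResolutionOfSingularities.Theorems.FrobeniusLadderFRationalResolutionFRationalLocalizesScheme
import Summits.ResolutionOfSingularities.ResolutionOfSingularities.Theorems.FrobeniusLadderFRationalResolutionWeaklyFRegularSurfaceLocal
import Summits.ResolutionOfSingularities.ResolutionOfSingularities.Theorems.FrobeniusLadderFRationalResolutionGorensteinGermIdentityModel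
import Summits.ResolutionOfSingularities.ResolutionOfSingularities.Theorems.FrobeniusLadderFRationalResolutionModelIntegral
import Summits.ResolutionOfSingularities.ResolutionOfSingularities.Theorems.FrobeniusLadderFRationalResolutionModelDimension
import Summits.ResolutionOfSingularities.ResolutionOfSingularities.Theorems.FrobeniusLadderFRationalResolutionSurfacesOfGerms
import Summits.ResolutionOfSingularities.ResolutionOfSingularities.Theorems.FrobeniusLadderFRationalResolutionSurfaceRungsOfGerms
import Summits.ResolutionOfSingularities.ResolutionOfSingularities.Theorems.FrobeniusLadderFRationalResolutionStalkIsoSpread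
import Summits.ResolutionOfSingularities.ResolutionOfSingularities.Theorems.FrobeniusLadderFRationalResolutionRegularLocusOpenImmersion
import Summits.ResolutionOfSingularities.ResolutionOfSingularities.Theorems.FrobeniusLadderFRationalResolutionAnRegularLocus
import Summits.ResolutionOfSingularities.ResolutionOfSingularities.Theorems.FrobeniusLadderFRationalResolutionMutualInverseOpenImmersion
import Summits.ResolutionOfSingularities.ResolutionOfSingularities.Theorems.FrobeniusLadderFRationalResolutionGermEqLocal
import Summits.ResolutionOfSingularities.ResolutionOfSingularities.Theorems.FrobeniusLadderFRationalResolutionStalkIsoNhd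
import Summits.ResolutionOfSingularities.ResolutionOfSingularities.Theorems.FrobeniusLadderFRationalResolutionFRationalSurfaceAnStalks
import Summits.ResolutionOfSingularities.ResolutionOfSingularities.Theorems.FrobeniusLadderFRationalResolutionStalkIsoOpensIso
import Summits.ResolutionOfSingularities.ResolutionOfSingularities.Theorems.FrobeniusLadderFRationalResolutionAnStalkLocalResolution
import HarnessLib

/-!
# Skeleton `Sketch` (rung insertion + transport) for crux stmt-ResolutionOfSingularities-15317
`FrobeniusLadder.FRationalResolution`

Line lead (prover-line-stmt-ResolutionOfSingularities-15317-0), 2026-08-16. The crux is RESOLUTION OF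
F-RATIONAL VARIETIES in transport-closed form: for every prime `p`, field `k` of characteristic `p` and
reduced separated finite-type `X/k`, an F-rational locally-integral proper birational model `X' → X`
(every stalk a domain in which every ideal generated by a system of parameters is tightly closed, inline
form) gives `Scheme.HasResolution X`. It is the summit restricted to the residual class (route header:
"ranked last deliberately"; `[difficulty: open-problem]`).

The only line (`Sketch`, crux-ideate round 1 = cards `test-ideal-rung-to-f-regular` and
`hk-datum-tame-on-f-rational`) contains one composition onto the crux: card 2's RUNG INSERTION
`WeaklyFRegularModification → WeaklyFRegularResolution → FRationalResolution`. The lead reshapes it into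
registered stubs, making the crux's folklore transport explicit (and provable now) and isolating the two
research-sized rungs in their INTEGRAL form:

* `stub_transport` (worker): the crux for `X` follows from resolving the F-rational model `X'` itself
  (`Scheme.HasResolution.of_isBirational`; `X'` is again separated of finite type over `k` since `π` is
  proper).
* `stub_components` (worker): a finite-type `k`-scheme whose stalks are domains has a resolution as soon as
  each of its integral OPEN subschemes has one (its irreducible components are clopen:
  `isOpen_of_mem_irreducibleComponents_of_isDomain_stalk`; glue with
  `hasResolution_of_irreducibleComponents`, identifying the reduced subscheme on a clopen component with
  the open subscheme through `IsClosedImmersion.liftOfRange` / `isIso_of_isClosedImmersion_of_surjective`).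
* `stub_clause_of_ringEquiv` (worker): the crux's inline stalk clause ("domain, and every s.o.p. ideal
  tightly closed") is invariant under ring isomorphisms (used along the stalk isomorphisms of an open
  immersion).
* `stub_weaklyFRegularModification` (LEAD, rung 3½ of card 2, OPEN PROBLEM): an integral F-rational
  `X/k` has a proper birational model all of whose stalks are domains with EVERY ideal tightly closed.
* `stub_weaklyFRegularResolution` (LEAD, rung 4′ of card 2, OPEN PROBLEM): weakly F-regular
  locally-integral `X/k` have resolutions.
* `stub_rungsOfSummit` (worker, the route's kill-criterion sanity for the inserted rungs): the summit
  gives every reduced `X` a weakly F-regular proper birational model (a resolution: regular local rings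
  are domains with all ideals tightly closed, `isTightlyClosed_of_isRegularLocalRing`), so both rungs are
  summit-implied and cannot collide with a negative short of `¬` summit.

Composition: `integralCore` (rungs 3½ + 4′ + `of_isBirational`) → `locallyIntegralCore`
(`stub_components` + `stub_clause_of_ringEquiv` along `j.stalkMap`) → `FRationalResolution_of`
(`stub_transport`). The by-product `fRationalResolution_iff_integral` (crux ↔ "every integral F-rational
variety over `k` has a resolution") uses only the three worker stubs.

Every `sorry` of this file is inside a `stub_*`.

Continuation seat c2 (2026-08-17): section "By-product stubs of continuation seat c2" registered the
SUSPENSION CALIBRATION stubs — ALL LANDED (p133550 p133720 p133842 p133889 p133936 p133961 p133997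
p134523) together with the lead's assembly (p134413 p135017 p135199, theorem `suspension_calibration`);
the composition `FRationalResolution_of` is unchanged and the only sorries left are rungs 3½/4′.
-/

set_option linter.dupNamespace false

noncomputable section

open CategoryTheory AlgebraicGeometry TopologicalSpace
open Literature.AlgebraicGeometry.Resolution Literature.RingTheory.TightClosure
open scoped BigOperators
open Summit.ResolutionOfSingularities.ResolutionOfSingularities.Theses.FrobeniusLadder (FRationalResolution)

namespace Summit.ResolutionOfSingularities.ResolutionOfSingularities.Cruxes.FRationalResolution.Lines.Sketch

/-! ## Worker stubs (transport, components, invariance) -/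

/-- STUB (worker) — LANDED p128647 (`Theorems/FrobeniusLadderFRationalResolutionStubTransport.lean`). TRANSPORT: if every separated finite-type `k`-scheme whose stalks satisfy the crux's
F-rational clause has a resolution, then every `X/k` admitting an F-rational proper birational model has
one (`Scheme.HasResolution.of_isBirational`; the model is separated of finite type over `k` through
`π ≫ f`, `π` proper). -/
theorem stub_transport (p : ℕ) (k : Type) [Field k] (X : Scheme.{0}) (f : X ⟶ Spec (.of k))
    [IsSeparated f] [LocallyOfFiniteType f] [QuasiCompact f]
    (hcore : ∀ (X' : Scheme.{0}) (g : X' ⟶ Spec (.of k)), IsSeparated g → LocallyOfFiniteType g →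
      QuasiCompact g →
      (∀ x : X', IsDomain (X'.presheaf.stalk x) ∧ ∀ d : ℕ, ringKrullDim (X'.presheaf.stalk x) = d →
        ∀ s : Fin d → X'.presheaf.stalk x, (Ideal.span (Set.range s)).radical.IsMaximal →
        ∀ y c : X'.presheaf.stalk x, c ≠ 0 →
        (∀ e : ℕ, c * y ^ p ^ e ∈ Ideal.span ((fun z : X'.presheaf.stalk x => z ^ p ^ e) ''
          (Ideal.span (Set.range s) : Set (X'.presheaf.stalk x)))) → y ∈ Ideal.span (Set.range s)) →
      Scheme.HasResolution X')
    (hmodel : ∃ (X' : Scheme.{0}) (π : X' ⟶ X), IsProper π ∧ IsBirational π ∧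
      ∀ x : X', IsDomain (X'.presheaf.stalk x) ∧ ∀ d : ℕ, ringKrullDim (X'.presheaf.stalk x) = d →
        ∀ s : Fin d → X'.presheaf.stalk x, (Ideal.span (Set.range s)).radical.IsMaximal →
        ∀ y c : X'.presheaf.stalk x, c ≠ 0 →
        (∀ e : ℕ, c * y ^ p ^ e ∈ Ideal.span ((fun z : X'.presheaf.stalk x => z ^ p ^ e) ''
          (Ideal.span (Set.range s) : Set (X'.presheaf.stalk x)))) → y ∈ Ideal.span (Set.range s)) :
    Scheme.HasResolution X :=
  Theorems.FRationalResolution.Transport.stub_transport p k X f hcore hmodel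

/-- STUB (worker) — LANDED p128804 (`Theorems/FrobeniusLadderFRationalResolutionStubComponents.lean`). COMPONENTS: a `k`-scheme of finite type all of whose local rings are domains has a
resolution of singularities as soon as every integral open subscheme of it has one. (Its irreducible
components are clopen — `isOpen_of_mem_irreducibleComponents_of_isDomain_stalk` — finitely many, and the
open subscheme on a component is integral; glue with `hasResolution_of_irreducibleComponents`, the reduced
closed subscheme on a clopen component being isomorphic to the open subscheme.) -/
theorem stub_components (k : Type) [Field k] (X : Scheme.{0}) (f : X ⟶ Spec (.of k))
    [LocallyOfFiniteType f] [QuasiCompact f] (hdom : ∀ x : X, IsDomain (X.presheaf.stalk x))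
    (hres : ∀ (U : Scheme.{0}) (j : U ⟶ X), IsOpenImmersion j → IsIntegral U →
      Scheme.HasResolution U) :
    Scheme.HasResolution X :=
  Theorems.FRationalResolution.Components.stub_components k X f hdom hres

/-- STUB (worker) — LANDED p128710 (`Theorems/FrobeniusLadderFRationalResolutionStubClauseOfRingEquiv.lean`). INVARIANCE: the crux's inline stalk clause — "`R` is a domain and every ideal generated
by a system of parameters (`d = dim R` elements generating an ideal with maximal radical) is tightly
closed: `c ≠ 0 ∧ (∀ e, c·y^(p^e) ∈ span {z^(p^e) | z ∈ (s)}) ⇒ y ∈ (s)`" — transports along a ring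
isomorphism `φ : R ≃+* S`. -/
theorem stub_clause_of_ringEquiv (p : ℕ) {R S : Type} [CommRing R] [CommRing S] (φ : R ≃+* S)
    (h : IsDomain R ∧ ∀ d : ℕ, ringKrullDim R = d → ∀ s : Fin d → R,
      (Ideal.span (Set.range s)).radical.IsMaximal → ∀ y c : R, c ≠ 0 →
      (∀ e : ℕ, c * y ^ p ^ e ∈ Ideal.span ((fun z : R => z ^ p ^ e) ''
        (Ideal.span (Set.range s) : Set R))) → y ∈ Ideal.span (Set.range s)) :
    IsDomain S ∧ ∀ d : ℕ, ringKrullDim S = d → ∀ s : Fin d → S,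
      (Ideal.span (Set.range s)).radical.IsMaximal → ∀ y c : S, c ≠ 0 →
      (∀ e : ℕ, c * y ^ p ^ e ∈ Ideal.span ((fun z : S => z ^ p ^ e) ''
        (Ideal.span (Set.range s) : Set S))) → y ∈ Ideal.span (Set.range s) :=
  Theorems.FRationalResolution.ClauseInvariance.stub_clause_of_ringEquiv p φ h

/-! ## The two inserted rungs (card `test-ideal-rung-to-f-regular`), integral forms — LEAD -/

/-- STUB (lead; RUNG 3½, OPEN PROBLEM — F-REGULARIZATION OF F-RATIONAL VARIETIES). An integral separated
`k`-scheme of finite type all of whose stalks are F-rational (every s.o.p. ideal tightly closed, inline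
form) admits a proper birational model all of whose stalks are domains in which EVERY ideal is tightly
closed (weakly F-regular). Card 2's engine: Kawasaki/Česnavičius induction with the finitistic test ideal
`τ = ⋂ (I : I^*)` as uniform annihilator and centre. No theorem of this shape is in print beyond
dimension 2. -/
theorem stub_weaklyFRegularModification (p : ℕ) (hp : p.Prime) (k : Type) [Field k] [CharP k p]
    (X : Scheme.{0}) (f : X ⟶ Spec (.of k)) [IsSeparated f] [LocallyOfFiniteType f] [QuasiCompact f]
    [IsIntegral X]
    (hFR : ∀ x : X, IsDomain (X.presheaf.stalk x) ∧ ∀ d : ℕ, ringKrullDim (X.presheaf.stalk x) = d →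
      ∀ s : Fin d → X.presheaf.stalk x, (Ideal.span (Set.range s)).radical.IsMaximal →
      ∀ y c : X.presheaf.stalk x, c ≠ 0 →
      (∀ e : ℕ, c * y ^ p ^ e ∈ Ideal.span ((fun z : X.presheaf.stalk x => z ^ p ^ e) ''
        (Ideal.span (Set.range s) : Set (X.presheaf.stalk x)))) → y ∈ Ideal.span (Set.range s)) :
    ∃ (X' : Scheme.{0}) (π : X' ⟶ X), IsProper π ∧ IsBirational π ∧
      ∀ x : X', IsDomain (X'.presheaf.stalk x) ∧ ∀ I : Ideal (X'.presheaf.stalk x),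
        ∀ y c : X'.presheaf.stalk x, c ≠ 0 →
        (∀ e : ℕ, c * y ^ p ^ e ∈ Ideal.span ((fun z : X'.presheaf.stalk x => z ^ p ^ e) ''
          (I : Set (X'.presheaf.stalk x)))) → y ∈ I := by
  sorry

/-- STUB (lead; RUNG 4′, OPEN PROBLEM — RESOLUTION OF WEAKLY F-REGULAR VARIETIES). A separated
`k`-scheme of finite type all of whose stalks are domains in which every ideal is tightly closed (inline
form) has a resolution of singularities. By the calibration note `NEGATIVE-suspension-calibration.md`
(hyperbolic suspensions `yz + f` are strongly F-regular for every `f`) this class contains, as singular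
loci, every hypersurface singularity two dimensions down. -/
theorem stub_weaklyFRegularResolution (p : ℕ) (hp : p.Prime) (k : Type) [Field k] [CharP k p]
    (X : Scheme.{0}) (f : X ⟶ Spec (.of k)) [IsSeparated f] [LocallyOfFiniteType f] [QuasiCompact f]
    (hWFR : ∀ x : X, IsDomain (X.presheaf.stalk x) ∧ ∀ I : Ideal (X.presheaf.stalk x),
      ∀ y c : X.presheaf.stalk x, c ≠ 0 →
      (∀ e : ℕ, c * y ^ p ^ e ∈ Ideal.span ((fun z : X.presheaf.stalk x => z ^ p ^ e) ''
        (I : Set (X.presheaf.stalk x)))) → y ∈ I) :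
    Scheme.HasResolution X := by
  sorry

/-! ## Sanity: the inserted rungs are summit-implied (route KILL CRITERIA) -/

/-- STUB (worker) — LANDED p128779 (`Theorems/FrobeniusLadderFRationalResolutionStubRungsOfSummit.lean`). Under the summit, every reduced separated finite-type `X/k` (char `p` prime) has a
weakly F-regular locally-integral proper birational model — namely a resolution `X̃ → X`: a regular
local ring is a domain (`isDomain_of_isRegularLocalRing`) in which every ideal is tightly closed
(`Literature.RingTheory.TightClosure.isTightlyClosed_of_isRegularLocalRing`, unfolded by
`isTightlyClosed_iff_of_isDomain`; the stalks of `X̃` have characteristic `p` through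
`X̃ → X → Spec k`). Hence `stub_weaklyFRegularModification` and `stub_weaklyFRegularResolution` are both
consequences of the summit. -/
theorem stub_rungsOfSummit (hsummit : _root_.ResolutionOfSingularities) (p : ℕ) (hp : p.Prime)
    (k : Type) [Field k] [CharP k p] (X : Scheme.{0}) (f : X ⟶ Spec (.of k)) [IsSeparated f]
    [LocallyOfFiniteType f] [QuasiCompact f] [IsReduced X] :
    ∃ (X' : Scheme.{0}) (π : X' ⟶ X), IsProper π ∧ IsBirational π ∧
      ∀ x : X', IsDomain (X'.presheaf.stalk x) ∧ ∀ I : Ideal (X'.presheaf.stalk x),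
        ∀ y c : X'.presheaf.stalk x, c ≠ 0 →
        (∀ e : ℕ, c * y ^ p ^ e ∈ Ideal.span ((fun z : X'.presheaf.stalk x => z ^ p ^ e) ''
          (I : Set (X'.presheaf.stalk x)))) → y ∈ I :=
  Theorems.FRationalResolution.RungsOfSummit.stub_rungsOfSummit hsummit p hp k X f

/-! ## Composition -/

/-- The INTEGRAL CORE from the two rungs: an integral F-rational `X/k` has a resolution (rung 3½ gives a
weakly F-regular proper birational model `X' → X`, rung 4′ resolves `X'`, and resolutions transport
along proper birational maps). -/
theorem integralCore (p : ℕ) (hp : p.Prime) (k : Type) [Field k] [CharP k p]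
    (X : Scheme.{0}) (f : X ⟶ Spec (.of k)) [IsSeparated f] [LocallyOfFiniteType f] [QuasiCompact f]
    [IsIntegral X]
    (hFR : ∀ x : X, IsDomain (X.presheaf.stalk x) ∧ ∀ d : ℕ, ringKrullDim (X.presheaf.stalk x) = d →
      ∀ s : Fin d → X.presheaf.stalk x, (Ideal.span (Set.range s)).radical.IsMaximal →
      ∀ y c : X.presheaf.stalk x, c ≠ 0 →
      (∀ e : ℕ, c * y ^ p ^ e ∈ Ideal.span ((fun z : X.presheaf.stalk x => z ^ p ^ e) ''
        (Ideal.span (Set.range s) : Set (X.presheaf.stalk x)))) → y ∈ Ideal.span (Set.range s)) :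
    Scheme.HasResolution X := by
  obtain ⟨X', π, hπ, hbir, hW⟩ := stub_weaklyFRegularModification p hp k X f hFR
  haveI := hπ
  exact Scheme.HasResolution.of_isBirational π hbir
    (stub_weaklyFRegularResolution p hp k X' (π ≫ f) hW)

/-- The LOCALLY INTEGRAL CORE: a separated finite-type `X/k` whose stalks satisfy the F-rational clause has
a resolution (components + invariance of the clause along the stalk isomorphisms of an open immersion +
`integralCore`). -/
theorem locallyIntegralCore (p : ℕ) (hp : p.Prime) (k : Type) [Field k] [CharP k p]
    (X : Scheme.{0}) (f : X ⟶ Spec (.of k)) [IsSeparated f] [LocallyOfFiniteType f] [QuasiCompact f]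
    (hFR : ∀ x : X, IsDomain (X.presheaf.stalk x) ∧ ∀ d : ℕ, ringKrullDim (X.presheaf.stalk x) = d →
      ∀ s : Fin d → X.presheaf.stalk x, (Ideal.span (Set.range s)).radical.IsMaximal →
      ∀ y c : X.presheaf.stalk x, c ≠ 0 →
      (∀ e : ℕ, c * y ^ p ^ e ∈ Ideal.span ((fun z : X.presheaf.stalk x => z ^ p ^ e) ''
        (Ideal.span (Set.range s) : Set (X.presheaf.stalk x)))) → y ∈ Ideal.span (Set.range s)) :
    Scheme.HasResolution X := by
  refine stub_components k X f (fun x => (hFR x).1) fun U j hj hU => ?_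
  haveI := hj
  haveI := hU
  haveI : IsLocallyNoetherian X := LocallyOfFiniteType.isLocallyNoetherian f
  haveI : CompactSpace X := QuasiCompact.compactSpace_of_compactSpace f
  haveI : IsNoetherian X := { }
  haveI : NoetherianSpace U := j.isOpenEmbedding.isInducing.noetherianSpace
  refine integralCore p hp k U (j ≫ f) fun u => ?_
  exact stub_clause_of_ringEquiv p (asIso (j.stalkMap u)).commRingCatIsoToRingEquiv (hFR (j.base u))

/-- Composition: the crux BY NAME from the stubs. -/
theorem FRationalResolution_of : FRationalResolution := by
  intro p hp k _ _ X f hsep hft hqc _ hmodel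
  haveI := hsep
  haveI := hft
  haveI := hqc
  exact stub_transport p k X f (fun X' g hs hl hq hFR => by
    haveI := hs
    haveI := hl
    haveI := hq
    exact locallyIntegralCore p hp k X' g hFR) hmodel

/-- BY-PRODUCT (worker stubs only): the crux is EQUIVALENT to its integral form — "for every prime `p`,
field `k` of characteristic `p` and INTEGRAL separated `X/k` of finite type whose stalks are F-rational
(inline clause), `X` has a resolution" (forward: `X` is its own F-rational model along `𝟙 X`; backward:
transport + components + invariance). -/
theorem fRationalResolution_iff_integral :
    FRationalResolution ↔ ∀ p : ℕ, p.Prime → ∀ (k : Type) [Field k] [CharP k p] (X : Scheme.{0})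
      (f : X ⟶ Spec (.of k)), IsSeparated f → LocallyOfFiniteType f → QuasiCompact f → IsIntegral X →
      (∀ x : X, IsDomain (X.presheaf.stalk x) ∧ ∀ d : ℕ, ringKrullDim (X.presheaf.stalk x) = d →
        ∀ s : Fin d → X.presheaf.stalk x, (Ideal.span (Set.range s)).radical.IsMaximal →
        ∀ y c : X.presheaf.stalk x, c ≠ 0 →
        (∀ e : ℕ, c * y ^ p ^ e ∈ Ideal.span ((fun z : X.presheaf.stalk x => z ^ p ^ e) ''
          (Ideal.span (Set.range s) : Set (X.presheaf.stalk x)))) → y ∈ Ideal.span (Set.range s)) →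
      Scheme.HasResolution X := by
  constructor
  · intro h p hp k _ _ X f hsep hft hqc hint hFR
    refine h p hp k X f hsep hft hqc inferInstance ⟨X, 𝟙 X, inferInstance, ⟨⊤, ?_, ?_, ?_⟩, hFR⟩
    · simp
    · simp
    · infer_instance
  · intro hint p hp k _ _ X f hsep hft hqc _ hmodel
    haveI := hsep
    haveI := hft
    haveI := hqc
    refine stub_transport p k X f (fun X' g hs hl hq hFR => ?_) hmodel
    haveI := hs
    haveI := hl
    haveI := hq
    refine stub_components k X' g (fun x => (hFR x).1) fun U j hj hU => ?_
    haveI := hj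
    haveI := hU
    haveI : IsLocallyNoetherian X' := LocallyOfFiniteType.isLocallyNoetherian g
    haveI : CompactSpace X' := QuasiCompact.compactSpace_of_compactSpace g
    haveI : IsNoetherian X' := { }
    haveI : NoetherianSpace U := j.isOpenEmbedding.isInducing.noetherianSpace
    exact hint p hp k U (j ≫ g) inferInstance inferInstance inferInstance hU fun u =>
      stub_clause_of_ringEquiv p (asIso (j.stalkMap u)).commRingCatIsoToRingEquiv (hFR (j.base u))

/-! ## By-product stubs of continuation seat c2 (2026-08-17): the SUSPENSION CALIBRATION in Lean

`NEGATIVE-suspension-calibration.md` (crux-ideate r1) prices rung 4′: the hyperbolic suspension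
`Σf = Spec k[x₁..xₙ][y,z]/(yz + f)` is (strongly) F-regular for EVERY `f ≠ 0`, and singular exactly over
`Sing V(f) × {y = z = 0}`; so the residual class of the crux contains every hypersurface singularity
two dimensions down. The stubs below make this a theorem for EVERY field `k` of characteristic `p`
(no F-finiteness): Glassbrenner's elementwise condition `c·g^(q−1) ∉ 𝔪^[q]` forces all ideals of
`S/(g)` to be tightly closed w.r.t. `c` by Kunz's flat colon (`stub_glassbrennerQuotient`, the
tight-closure twin of the stmt-15315 line's `Fedder.mem_sup_span_of_pow_mem`); for `g = yz + f` the
condition holds for ALL `c ∉ (g)` because the `y^U z^V`-coefficient of `c·g^(q−1)` at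
`(U, V) = (q−1, q−1−D)` is `± f^D · [T^D] c(x, T, −f/T)` (`stub_suspensionCoeff`,
`stub_suspensionKernel`, lead: `stub_suspension_pow_expand`); Frobenius powers of primes of a regular
ring are contracted from the localization (`stub_notMem_frobeniusPower_atPrime`); points with `y ∉ P`
or `z ∉ P` are regular points (`stub_clause_of_derivation`, `∂g/∂z = y`); Spec/stalk glue
(`stub_specHypersurface`); non-regularity at the origin for `f ∈ (x)²`
(`stub_suspension_not_regular`). Computations live in `k[x][y,z] = MvPolynomial (Fin 2) (MvPolynomial (Fin n) k)`,
local rings in `MvPolynomial (Fin 2 ⊕ Fin n) k` (bridge: `MvPolynomial.sumAlgEquiv`), because the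
quotient-of-localization type does not elaborate over the iterated polynomial ring. -/

/-- STUB (worker W1) — LANDED p133720 (`Theorems/FrobeniusLadderFRationalResolutionGlassbrennerQuotient.lean`) — GLASSBRENNER'S ELEMENTWISE CRITERION, QUOTIENT FORM. `(S, 𝔪)` regular local of
characteristic `p`, `g ∈ S`. If every `c ∉ (g)` admits `q = p^e` with `c·g^(q−1) ∉ 𝔪^[q]`, then every
ideal of `S/(g)` is tightly closed in the crux's inline sense. Proof (one `e` suffices): lift to `S`;
`c y^q ∈ J^[q] + (g)` gives `c g^(q−1) y^q ∈ (J + (g))^[q]`, so by Kunz's flat colon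
(`mem_frobeniusPower_colon_of_isRegularLocalRing`) `c g^(q−1) ∈ ((J + (g)) : y)^[q] ⊆ 𝔪^[q]` unless
`y ∈ J + (g)`. Template: `Theorems/FrobeniusLadderFInjectiveMacaulayficationFedderClosure.lean`.
[Glassbrenner 1996, Hochster–Huneke 1989 Thm 3.3 — here splitting-free.] -/
theorem stub_glassbrennerQuotient (p : ℕ) [Fact p.Prime] (S : Type) [CommRing S]
    [IsRegularLocalRing S] [CharP S p] (g : S)
    (hG : ∀ c : S, c ∉ Ideal.span {g} → ∃ e : ℕ,
      c * g ^ (p ^ e - 1) ∉ frobeniusPower (p ^ e) (IsLocalRing.maximalIdeal S))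
    (I : Ideal (S ⧸ Ideal.span {g})) (y c : S ⧸ Ideal.span {g}) (hc : c ≠ 0)
    (hy : ∀ e : ℕ, c * y ^ p ^ e ∈
      Ideal.span ((fun z : S ⧸ Ideal.span {g} => z ^ p ^ e) '' (I : Set (S ⧸ Ideal.span {g})))) :
    y ∈ I :=
  Theorems.FRationalResolution.stub_glassbrennerQuotient p S g hG I y c hc hy

/-- STUB (worker W2) — LANDED p133889 (`Theorems/FrobeniusLadderFRationalResolutionFrobeniusPowerAtPrime.lean`) — FROBENIUS POWERS OF PRIMES ARE CONTRACTED (transfer of non-membership from a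
maximal ideal to the local ring at a smaller prime). `S` a domain of characteristic `p`, `P ⊆ M`,
`P` prime, `M` maximal with `S_M` regular local. If `s ∉ M^[q]` then `s/1 ∉ (P S_P)^[q]`. Proof: else
`u s ∈ P^[q]` for some `u ∉ P`; in the regular local ring `S_M`, Kunz's flat colon
(`mem_frobeniusPower_colon_of_isRegularLocalRing` with `I = P S_M`, `x = u`, `c = s`) gives
`s ∈ ((P S_M) : u)^[q] = (P S_M)^[q] ⊆ (M S_M)^[q]`, and `(M S_M)^[q] ∩ S = M^[q]` (`M^[q]` is
`M`-primary: `M ⊔ (w) = ⊤ ⇒ M^[q] ⊔ (w) = ⊤` by raising `m + a w = 1` to the `q`-th power). -/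
theorem stub_notMem_frobeniusPower_atPrime (p : ℕ) [Fact p.Prime] (S : Type) [CommRing S]
    [IsDomain S] [CharP S p] (P M : Ideal S) [P.IsPrime] [M.IsMaximal] (hPM : P ≤ M)
    [IsRegularLocalRing (Localization.AtPrime M)] (e : ℕ) (s : S)
    (hs : s ∉ frobeniusPower (p ^ e) M) :
    algebraMap S (Localization.AtPrime P) s ∉
      frobeniusPower (p ^ e) (IsLocalRing.maximalIdeal (Localization.AtPrime P)) :=
  Theorems.FRationalResolution.stub_notMem_frobeniusPower_atPrime p S P M hPM e s hs

/-- STUB (worker W3) — LANDED p133936 (`Theorems/FrobeniusLadderFRationalResolutionSuspensionCoeff.lean`) — THE COEFFICIENT IDENTITY. In `A[y,z]` (`y = X 0`, `z = X 1`, any commutative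
`A`), given the characteristic-`p` expansion `(yz + f)^(q−1) = Σ_{j<q} (−1)^j f^(q−1−j) y^j z^j`
(hypothesis `hexp`; `C(q−1, j) ≡ (−1)^j`), the `y^(q−1) z^(q−1−d)`-coefficient of `c·(yz+f)^(q−1)` is
`(−1)^(q−1+d) f^d · T_d(c)` and the `y^(q−1−d) z^(q−1)`-coefficient is `(−1)^(q−1) · T_(−d)(c)`, where
`T_D(c) = Σ_{m ∈ supp c, m₀ − m₁ = D} (−1)^(m₁) c_m f^(m₁)` (`= [T^D] c(T, −f/T)`), provided all
exponents of `c` and `d` are `< q`. Pure `MvPolynomial.coeff_mul` bookkeeping. -/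
theorem stub_suspensionCoeff (A : Type) [CommRing A] (f : A) (c : MvPolynomial (Fin 2) A)
    (q d : ℕ) (hd : d < q) (hc : ∀ m ∈ c.support, m 0 < q ∧ m 1 < q)
    (hexp : (MvPolynomial.X 0 * MvPolynomial.X 1 + MvPolynomial.C f : MvPolynomial (Fin 2) A) ^ (q - 1)
      = ∑ j ∈ Finset.range q, MvPolynomial.monomial (Finsupp.single 0 j + Finsupp.single 1 j)
          ((-1) ^ j * f ^ (q - 1 - j))) :
    MvPolynomial.coeff (Finsupp.single 0 (q - 1) + Finsupp.single 1 (q - 1 - d))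
        (c * (MvPolynomial.X 0 * MvPolynomial.X 1 + MvPolynomial.C f) ^ (q - 1)) =
      (-1) ^ (q - 1 + d) * f ^ d *
        (∑ m ∈ c.support with ((m 0 : ℤ) - (m 1 : ℤ) = (d : ℤ)),
          (-1) ^ (m 1) * MvPolynomial.coeff m c * f ^ (m 1)) ∧
    MvPolynomial.coeff (Finsupp.single 0 (q - 1 - d) + Finsupp.single 1 (q - 1))
        (c * (MvPolynomial.X 0 * MvPolynomial.X 1 + MvPolynomial.C f) ^ (q - 1)) =
      (-1) ^ (q - 1) *
        (∑ m ∈ c.support with ((m 0 : ℤ) - (m 1 : ℤ) = -(d : ℤ)),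
          (-1) ^ (m 1) * MvPolynomial.coeff m c * f ^ (m 1)) :=
  Theorems.FRationalResolution.stub_suspensionCoeff A f c q d hd hc hexp

/-- STUB (worker W4) — LANDED p133961 (`Theorems/FrobeniusLadderFRationalResolutionSuspensionKernel.lean`) — `(yz + f)` IS THE KERNEL OF `A[y,z] → A[T, T⁻¹]`, `y ↦ T`, `z ↦ −f T⁻¹`
(`A` a domain, `f ≠ 0`): hence `(yz + f)` is prime, and every `c ∉ (yz + f)` has some non-zero
Laurent coefficient `T_D(c) = [T^D] c(T, −f/T) = Σ_{m₀ − m₁ = D} (−1)^(m₁) c_m f^(m₁)`. Proof: the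
`A`-algebra map `ψ = MvPolynomial.aeval ![T 1, −C f * T (−1)]` kills `yz + f`; `[T^D] ψ c = T_D(c)`;
every monomial `y^a z^b ≡ (−f)^(min a b) · (y^(a−b) or z^(b−a))` modulo `(yz + f)`, so `c` is
congruent to a normal form in `A[y] + z A[z]` on which `ψ` is injective (`f^m ≠ 0`). -/
theorem stub_suspensionKernel (A : Type) [CommRing A] [IsDomain A] (f : A) (hf : f ≠ 0) :
    (Ideal.span {(MvPolynomial.X 0 * MvPolynomial.X 1 + MvPolynomial.C f :
        MvPolynomial (Fin 2) A)}).IsPrime ∧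
    ∀ c : MvPolynomial (Fin 2) A,
      c ∉ Ideal.span {(MvPolynomial.X 0 * MvPolynomial.X 1 + MvPolynomial.C f :
        MvPolynomial (Fin 2) A)} →
      ∃ D : ℤ, (∑ m ∈ c.support with ((m 0 : ℤ) - (m 1 : ℤ) = D),
          (-1) ^ (m 1) * MvPolynomial.coeff m c * f ^ (m 1)) ≠ 0 :=
  Theorems.FRationalResolution.stub_suspensionKernel A f hf

/-- STUB (worker W5) — LANDED p133842 (`Theorems/FrobeniusLadderFRationalResolutionClauseOfDerivation.lean`) — SMOOTH POINTS OF A HYPERSURFACE VIA A DERIVATION. `S` a domain of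
characteristic `p` with `S_P` regular local, `g ∈ P`, and a derivation `D` with `D g ∉ P`. Then
`g ∉ (P S_P)²` (if `u g ∈ P²` with `u ∉ P` then `D(u g) = u·D g + g·D u ∈ P` forces `u D g ∈ P`), so
`S_P/(g)` is a regular local ring (`IsRegularLocalRing.quotient_span_singleton`, in tree), hence a
domain in which every ideal is tightly closed (`isTightlyClosed_of_isRegularLocalRing` +
`isTightlyClosed_iff_of_isDomain`, in tree) — the crux's clause in its weakly-F-regular inline form. -/
theorem stub_clause_of_derivation (p : ℕ) [Fact p.Prime] (R S : Type) [CommRing R] [CommRing S]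
    [Algebra R S] [IsDomain S] [CharP S p] (P : Ideal S) [P.IsPrime]
    [IsRegularLocalRing (Localization.AtPrime P)] (D : Derivation R S S) (g : S) (hg : g ∈ P)
    (hD : D g ∉ P) :
    IsDomain (Localization.AtPrime P ⧸ Ideal.span {algebraMap S (Localization.AtPrime P) g}) ∧
    ∀ (I : Ideal (Localization.AtPrime P ⧸ Ideal.span {algebraMap S (Localization.AtPrime P) g}))
      (y c : Localization.AtPrime P ⧸ Ideal.span {algebraMap S (Localization.AtPrime P) g}),
      c ≠ 0 →
      (∀ e : ℕ, c * y ^ p ^ e ∈ Ideal.span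
        ((fun z : Localization.AtPrime P ⧸ Ideal.span {algebraMap S (Localization.AtPrime P) g} =>
          z ^ p ^ e) '' (I : Set (Localization.AtPrime P ⧸
            Ideal.span {algebraMap S (Localization.AtPrime P) g})))) →
      y ∈ I :=
  Theorems.FRationalResolution.stub_clause_of_derivation p R S P D g hg hD

/-- STUB (worker W6) — LANDED p134523 (`Theorems/FrobeniusLadderFRationalResolutionSpecHypersurface.lean`) — SPEC OF A HYPERSURFACE IN A FINITE-TYPE ALGEBRA: GLUE. `S` of finite type over
a field `k`, `g ∈ S`. If for every prime `P ∋ g` the ring `S_P/(g)` is a domain in which every ideal is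
tightly closed (inline form), then `X = Spec (S/(g)) → Spec k` is separated, locally of finite type,
quasi-compact, `X` is reduced, and EVERY STALK of `X` is a domain with every ideal tightly closed —
because the stalk at `x = 𝔭` is `(S/(g))_𝔭 ≅ S_P/(g S_P)`, `P` the preimage of `𝔭`
(`StructureSheaf.stalkIso`; Mathlib's `IsLocalization` instance for `S_P ⧸ I·S_P` over `S ⧸ I` +
`IsLocalization.algEquiv`), and the clause transports along ring isomorphisms. The last conjunct records
the isomorphism pointwise (used by the lead for non-regularity). -/
theorem stub_specHypersurface (p : ℕ) (k : Type) [Field k] (S : Type) [CommRing S] [Algebra k S]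
    [Algebra.FiniteType k S] (g : S)
    (H : ∀ (P : Ideal S) [P.IsPrime], g ∈ P →
      IsDomain (Localization.AtPrime P ⧸ Ideal.span {algebraMap S (Localization.AtPrime P) g}) ∧
      ∀ (I : Ideal (Localization.AtPrime P ⧸ Ideal.span {algebraMap S (Localization.AtPrime P) g}))
        (y c : Localization.AtPrime P ⧸ Ideal.span {algebraMap S (Localization.AtPrime P) g}),
        c ≠ 0 →
        (∀ e : ℕ, c * y ^ p ^ e ∈ Ideal.span
          ((fun z : Localization.AtPrime P ⧸ Ideal.span {algebraMap S (Localization.AtPrime P) g} =>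
            z ^ p ^ e) '' (I : Set (Localization.AtPrime P ⧸
              Ideal.span {algebraMap S (Localization.AtPrime P) g})))) →
        y ∈ I) :
    let R := S ⧸ Ideal.span {g}
    let X := Spec (CommRingCat.of R)
    let φ : X ⟶ Spec (CommRingCat.of k) := Spec.map (CommRingCat.ofHom (algebraMap k R))
    IsSeparated φ ∧ LocallyOfFiniteType φ ∧ QuasiCompact φ ∧ IsReduced X ∧
    (∀ x : X, IsDomain (X.presheaf.stalk x) ∧
      ∀ (I : Ideal (X.presheaf.stalk x)) (y c : X.presheaf.stalk x), c ≠ 0 →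
        (∀ e : ℕ, c * y ^ p ^ e ∈
          Ideal.span ((fun z : X.presheaf.stalk x => z ^ p ^ e) '' (I : Set (X.presheaf.stalk x)))) →
        y ∈ I) ∧
    (∀ (P : Ideal S) [P.IsPrime], g ∈ P → ∃ x : X,
      Nonempty (X.presheaf.stalk x ≃+*
        Localization.AtPrime P ⧸ Ideal.span {algebraMap S (Localization.AtPrime P) g})) :=
  Theorems.FRationalResolution.stub_specHypersurface p k S g H

/-- STUB (worker W7) — LANDED p133997 (`Theorems/FrobeniusLadderFRationalResolutionSuspensionNotRegular.lean`) — THE SUSPENSION IS SINGULAR AT THE ORIGIN WHEN `f ∈ (x)²`. In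
`S = k[y, z, x₁..xₙ] = MvPolynomial (Fin 2 ⊕ Fin n) k` the origin `M = (all variables)` is maximal,
`g = yz + f ∈ M²` (as `f ∈ (x)²`), `g ≠ 0`, `S_M` is regular local (Mathlib instance), and a regular
local ring modulo a NON-ZERO element of `𝔪²` is never regular: `μ(𝔪/(g)) = μ(𝔪)` by Nakayama while
`dim S_M/(g) + 1 = dim S_M = μ(𝔪)` (`ringKrullDim_quotient_span_singleton_succ_eq_ringKrullDim`). -/
theorem stub_suspension_not_regular (k : Type) [Field k] (n : ℕ) (f : MvPolynomial (Fin n) k)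
    (hf0 : f ≠ 0)
    (hf2 : f ∈ (Ideal.span (Set.range MvPolynomial.X) : Ideal (MvPolynomial (Fin n) k)) ^ 2) :
    (Ideal.span (Set.range MvPolynomial.X) : Ideal (MvPolynomial (Fin 2 ⊕ Fin n) k)).IsMaximal ∧
    ∀ (M : Ideal (MvPolynomial (Fin 2 ⊕ Fin n) k)) [M.IsMaximal],
      M = Ideal.span (Set.range MvPolynomial.X) →
      (MvPolynomial.X (Sum.inl 0) * MvPolynomial.X (Sum.inl 1) + MvPolynomial.rename Sum.inr f :
        MvPolynomial (Fin 2 ⊕ Fin n) k) ∈ M ∧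
      ¬ IsRegularLocalRing (Localization.AtPrime M ⧸ Ideal.span {algebraMap
        (MvPolynomial (Fin 2 ⊕ Fin n) k) (Localization.AtPrime M)
        (MvPolynomial.X (Sum.inl 0) * MvPolynomial.X (Sum.inl 1) + MvPolynomial.rename Sum.inr f)}) :=
  Theorems.FRationalResolution.stub_suspension_not_regular k n f hf0 hf2

/-- STUB (lead) — LANDED p133550 (`Theorems/FrobeniusLadderFRationalResolutionSuspensionPowExpand.lean`) — THE CHARACTERISTIC-`p` EXPANSION `(yz + f)^(p^e − 1) = Σ_{j < p^e} (−1)^j f^(p^e−1−j) (yz)^j`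
(`C(p^e − 1, j) ≡ (−1)^j (mod p)`: `(1+X)^(p^e−1)·(1+X) = 1 + X^(p^e)`). -/
theorem stub_suspension_pow_expand (p : ℕ) [Fact p.Prime] (A : Type) [CommRing A] [CharP A p] (f : A)
    (e : ℕ) :
    (MvPolynomial.X 0 * MvPolynomial.X 1 + MvPolynomial.C f : MvPolynomial (Fin 2) A) ^ (p ^ e - 1)
      = ∑ j ∈ Finset.range (p ^ e), MvPolynomial.monomial (Finsupp.single 0 j + Finsupp.single 1 j)
          ((-1) ^ j * f ^ (p ^ e - 1 - j)) :=
  Theorems.FRationalResolution.stub_suspension_pow_expand p A f e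

/-! ### Assembly of the calibration (lead; LANDED p134413 Bookkeeping, p135017 LocalClause, p135199 Calibration)

`suspension_localClause` (every `S_P/(yz+f)` is a domain with every ideal tightly closed, every field
`k`), `suspension_package` (Σf satisfies the crux hypothesis with the identity as model),
`fRationalResolution_resolves_suspension`, `suspension_not_isRegular`, and the headline below. -/

/-- **CALIBRATION (headline, landed as `Theorems.FRationalResolution.fRationalResolution_resolves_singular_suspension`).**
Under the crux, for every prime `p`, every field `k` of characteristic `p`, every `n` and every
`0 ≠ f ∈ (x₁..xₙ)²`, the hyperbolic suspension `Σf = Spec k[y,z,x]/(yz + f)` is a SINGULAR `k`-variety in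
the residual class which the crux must resolve. So `FRationalResolution` in dimension `n + 1` carries,
inside singular loci `Sing V(f) × {y = z = 0}`, every hypersurface singularity of dimension `n − 1`:
the route header's why-easier for rank 4 holds only pointwise (calibration note, Consequence 1). -/
theorem suspension_calibration (k : Type) [Field k] (n : ℕ) (f : MvPolynomial (Fin n) k) (p : ℕ)
    [Fact p.Prime] [CharP k p] (h : FRationalResolution) (hf0 : f ≠ 0)
    (hf2 : f ∈ (Ideal.span (Set.range MvPolynomial.X) : Ideal (MvPolynomial (Fin n) k)) ^ 2) :
    ¬ Scheme.IsRegular (Spec (CommRingCat.of (MvPolynomial (Fin 2 ⊕ Fin n) k ⧸ Ideal.span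
      {(MvPolynomial.X (Sum.inl 0) * MvPolynomial.X (Sum.inl 1) + MvPolynomial.rename Sum.inr f :
        MvPolynomial (Fin 2 ⊕ Fin n) k)}))) ∧
    Scheme.HasResolution (Spec (CommRingCat.of (MvPolynomial (Fin 2 ⊕ Fin n) k ⧸ Ideal.span
      {(MvPolynomial.X (Sum.inl 0) * MvPolynomial.X (Sum.inl 1) + MvPolynomial.rename Sum.inr f :
        MvPolynomial (Fin 2 ⊕ Fin n) k)}))) :=
  Theorems.FRationalResolution.fRationalResolution_resolves_singular_suspension k n f p h hf0 hf2

/-! ## By-product stubs of continuation seat c2, wave 2: RUNG 4′ AT THE FIRST SINGULAR MEMBERS OF THE CLASS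

With the calibration in hand (`suspension_calibration`: the crux must resolve every Σf), the lead
RESOLVES the first singular suspensions UNCONDITIONALLY, for every field `k`, by ONE blowing up of the
origin, using the tree's blow-up algebra (`AffineBlowup*.lean`, `BlowupAlgebraPresentation.lean`:
`affineBlowup I = Proj R[It]` is proper birational over `Spec R`, its charts are the affine blowup
algebras `R[I/a] ⊆ R[1/a]`, `reesChartEquiv`): Σ(x²) = {yz + x² = 0} (the quadric cone, a surface:
rung 4′ in dimension 2 was so far conditional on CJS2020, p131133), Σ(x₁x₂) = {yz + x₁x₂ = 0} (the
cone over `ℙ¹ × ℙ¹`, a threefold: dimension 3 was conditional on CP2019), and Σ(x³) = {yz + x³ = 0}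
(the `A₂` surface singularity). Every chart of these blow-ups is a POLYNOMIAL RING (graph or
elimination charts); the stubs below are the chart computations, abstracted over a `k`-algebra `R`
generated by the named elements with the named relation and a TEST MAP `θ` into a localized polynomial
ring (injectivity of the chart parametrisation is read off `θ`; surjectivity from `hgen` and the
relation); `stub_cover_sq` is the chart inclusion `D₊(xt) ⊆ D₊(yt)` for `yz + x² = 0`
(`(xt)² = −(yt)(zt)`). Assembly (lead): instances of the stubs at the concrete quotient rings,
regularity of `Proj` by the chart cover (pattern `affineBlowup.isRegular_of_isQuasiRegular`),
`affineBlowup.isResolution`. -/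

/-- STUB (worker U1) — LANDED p135901 (`Theorems/FrobeniusLadderFRationalResolutionChartGraphSq.lean`) — GRAPH CHART OF THE QUADRIC CONE. `R` a `k`-algebra generated by `x, y, z`
with `yz + x² = 0`, and a test map `θ : R → k[Y, X'][1/Y]` with `θ y = Y`, `θ x = X'Y`,
`θ z = −X'²Y`. Then the affine blowup algebra `R[I/y]`, `I = (x, y, z)`, is a regular ring — indeed
`k[Y, X'] → R[I/y]`, `Y ↦ y`, `X' ↦ x/y` is an isomorphism: surjective since `R[I/y]` is generated
over `R` by `x/y, z/y` (`blowupAlgebra.eval_surjective` / `div_mem_blowupAlgebra`) with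
`z/y = −(x/y)²`, `x = y·(x/y)`, `z = y·(z/y)`; injective because `θ` extends to `R[1/y]`
(`IsLocalization.Away.lift`, `θ y` a unit) and the composite `k[Y, X'] → R[I/y] ⊆ R[1/y] → k[Y,X'][1/Y]`
is the (injective) localization map. Regularity of `k[Y, X']`: Mathlib instance; transport:
`IsRegularRing.of_ringEquiv`. -/
theorem stub_chart_graph_sq (k R : Type) [Field k] [CommRing R] [Algebra k R] (x y z : R)
    (hrel : y * z + x ^ 2 = 0) (hgen : Algebra.adjoin k {x, y, z} = ⊤)
    (θ : R →ₐ[k] Localization.Away (MvPolynomial.X 0 : MvPolynomial (Fin 2) k))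
    (hθy : θ y = algebraMap (MvPolynomial (Fin 2) k) _ (MvPolynomial.X 0))
    (hθx : θ x = algebraMap (MvPolynomial (Fin 2) k) _ (MvPolynomial.X 1 * MvPolynomial.X 0))
    (hθz : θ z = -(algebraMap (MvPolynomial (Fin 2) k) _ (MvPolynomial.X 1 ^ 2 * MvPolynomial.X 0))) :
    IsRegularRing (blowupAlgebra (Ideal.span {x, y, z}) y) :=
  Theorems.FRationalResolution.stub_chart_graph_sq k R x y z hrel hgen θ hθy hθx hθz

/-- STUB (worker U2) — LANDED p135899 (`Theorems/FrobeniusLadderFRationalResolutionChartGraphProd.lean`) — GRAPH CHART OF THE CONE OVER `ℙ¹ × ℙ¹`. `R` a `k`-algebra generated by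
`x₁, x₂, y, z` with `yz + x₁x₂ = 0`, test map `θ : R → k[Y, X₁', X₂'][1/Y]`, `θ y = Y`, `θ xᵢ = Xᵢ'Y`,
`θ z = −X₁'X₂'Y`. Then `R[I/y]`, `I = (x₁, x₂, y, z)`, is a regular ring (`≅ k[Y, X₁', X₂']`:
`z/y = −(x₁/y)(x₂/y)`; same proof as `stub_chart_graph_sq`). -/
theorem stub_chart_graph_prod (k R : Type) [Field k] [CommRing R] [Algebra k R] (x₁ x₂ y z : R)
    (hrel : y * z + x₁ * x₂ = 0) (hgen : Algebra.adjoin k {x₁, x₂, y, z} = ⊤)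
    (θ : R →ₐ[k] Localization.Away (MvPolynomial.X 0 : MvPolynomial (Fin 3) k))
    (hθy : θ y = algebraMap (MvPolynomial (Fin 3) k) _ (MvPolynomial.X 0))
    (hθx₁ : θ x₁ = algebraMap (MvPolynomial (Fin 3) k) _ (MvPolynomial.X 1 * MvPolynomial.X 0))
    (hθx₂ : θ x₂ = algebraMap (MvPolynomial (Fin 3) k) _ (MvPolynomial.X 2 * MvPolynomial.X 0))
    (hθz : θ z = -(algebraMap (MvPolynomial (Fin 3) k) _
      (MvPolynomial.X 1 * MvPolynomial.X 2 * MvPolynomial.X 0))) :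
    IsRegularRing (blowupAlgebra (Ideal.span {x₁, x₂, y, z}) y) :=
  Theorems.FRationalResolution.stub_chart_graph_prod k R x₁ x₂ y z hrel hgen θ hθy hθx₁ hθx₂ hθz

/-- STUB (worker U3) — LANDED p135932 (`Theorems/FrobeniusLadderFRationalResolutionChartGraphCube.lean`) — GRAPH CHART OF THE `A₂` SURFACE `yz + x³ = 0`. As `stub_chart_graph_sq` with
`z/y = −(x/y)³·y`: `R[I/y] ≅ k[Y, X']`, test map `θ y = Y`, `θ x = X'Y`, `θ z = −X'³Y²`. -/
theorem stub_chart_graph_cube (k R : Type) [Field k] [CommRing R] [Algebra k R] (x y z : R)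
    (hrel : y * z + x ^ 3 = 0) (hgen : Algebra.adjoin k {x, y, z} = ⊤)
    (θ : R →ₐ[k] Localization.Away (MvPolynomial.X 0 : MvPolynomial (Fin 2) k))
    (hθy : θ y = algebraMap (MvPolynomial (Fin 2) k) _ (MvPolynomial.X 0))
    (hθx : θ x = algebraMap (MvPolynomial (Fin 2) k) _ (MvPolynomial.X 1 * MvPolynomial.X 0))
    (hθz : θ z = -(algebraMap (MvPolynomial (Fin 2) k) _
      (MvPolynomial.X 1 ^ 3 * MvPolynomial.X 0 ^ 2))) :
    IsRegularRing (blowupAlgebra (Ideal.span {x, y, z}) y) :=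
  Theorems.FRationalResolution.stub_chart_graph_cube k R x y z hrel hgen θ hθy hθx hθz

/-- STUB (worker U4) — LANDED p135877 (`Theorems/FrobeniusLadderFRationalResolutionChartElimCube.lean`) — ELIMINATION CHART OF THE `A₂` SURFACE `yz + x³ = 0` at `x`: `R[I/x]` is
generated over `R` by `y' = y/x`, `z' = z/x` with `y'z' + x = 0`, so `x = −y'z'`, `y = y'x`, `z = z'x`
are polynomials in `y', z'` and `R[I/x] ≅ k[Y', Z']`; test map `θ : R → k[Y', Z'][1/(Y'Z')]`,
`θ x = −Y'Z'`, `θ y = −Y'²Z'`, `θ z = −Y'Z'²`. -/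
theorem stub_chart_elim_cube (k R : Type) [Field k] [CommRing R] [Algebra k R] (x y z : R)
    (hrel : y * z + x ^ 3 = 0) (hgen : Algebra.adjoin k {x, y, z} = ⊤)
    (θ : R →ₐ[k] Localization.Away (MvPolynomial.X 0 * MvPolynomial.X 1 : MvPolynomial (Fin 2) k))
    (hθx : θ x = -(algebraMap (MvPolynomial (Fin 2) k) _ (MvPolynomial.X 0 * MvPolynomial.X 1)))
    (hθy : θ y = -(algebraMap (MvPolynomial (Fin 2) k) _ (MvPolynomial.X 0 ^ 2 * MvPolynomial.X 1)))
    (hθz : θ z = -(algebraMap (MvPolynomial (Fin 2) k) _ (MvPolynomial.X 0 * MvPolynomial.X 1 ^ 2))) :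
    IsRegularRing (blowupAlgebra (Ideal.span {x, y, z}) x) :=
  Theorems.FRationalResolution.stub_chart_elim_cube k R x y z hrel hgen θ hθx hθy hθz

/-- STUB (worker U5) — LANDED p135715 (`Theorems/FrobeniusLadderFRationalResolutionCoverSq.lean`) — THE `x`-CHART OF `Bl_{(x,y,z)}{yz + x² = 0}` IS COVERED BY THE `y`-CHART: in the
Rees algebra `(xt)² = x²t² = −(yz)t² = −(yt)(zt)`, so `D₊(xt) = D₊((xt)²) ⊆ D₊(yt)`
(`Proj.basicOpen_mul`, `Proj.basicOpen_pow`; `reesT a ha = a·t` as `monomial 1 a`, `coe_reesT`). -/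
theorem stub_cover_sq (R : Type) [CommRing R] (I : Ideal R) (x y z : R) (hx : x ∈ I) (hy : y ∈ I)
    (hz : z ∈ I) (hrel : y * z + x ^ 2 = 0) :
    Proj.basicOpen (reesGrading I) (reesT x hx) ≤ Proj.basicOpen (reesGrading I) (reesT y hy) :=
  Theorems.FRationalResolution.stub_cover_sq R I x y z hx hy hz hrel

/-! ### Assembly of wave 2 (lead; LANDED p136191 QuadricCone, p136559 ConeProd, p136579 ConeCube)

Rung 4′ (`stub_weaklyFRegularResolution`) VERIFIED UNCONDITIONALLY at three singular members of the
residual class, every field `k`: `hasResolution_quadricCone` (Σ(x²), surface), `hasResolution_coneProd`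
(Σ(x₁x₂), threefold), `hasResolution_coneCube` (Σ(x³) = A₂), each by ONE blowing up of the singular
point; with `suspension_not_isRegular` / `suspension_package`: singular, in the class, resolved. -/

/-- **RUNG 4′ AT SINGULAR MEMBERS OF THE CLASS (landed).** For every prime `p` and field `k` of
characteristic `p`: the quadric cone `{yz + x² = 0}`, the threefold cone `{yz + x₁x₂ = 0}` and the `A₂`
surface `{yz + x³ = 0}` are NOT regular and HAVE resolutions of singularities (one blow-up each). So the
composition of this skeleton is verified, unconditionally and by actual blowing ups, at the first
singular members of the residual class in dimensions 2 and 3. -/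
theorem rung4_at_first_singular_members (k : Type) [Field k] (p : ℕ) [Fact p.Prime] [CharP k p] :
    (¬ Scheme.IsRegular (Spec (CommRingCat.of (MvPolynomial (Fin 2 ⊕ Fin 1) k ⧸ Ideal.span
      {(MvPolynomial.X (Sum.inl 0) * MvPolynomial.X (Sum.inl 1) +
        MvPolynomial.rename Sum.inr (MvPolynomial.X 0 ^ 2) : MvPolynomial (Fin 2 ⊕ Fin 1) k)}))) ∧
    Scheme.HasResolution (Spec (CommRingCat.of (MvPolynomial (Fin 2 ⊕ Fin 1) k ⧸ Ideal.span
      {(MvPolynomial.X (Sum.inl 0) * MvPolynomial.X (Sum.inl 1) +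
        MvPolynomial.rename Sum.inr (MvPolynomial.X 0 ^ 2) : MvPolynomial (Fin 2 ⊕ Fin 1) k)})))) ∧
    (¬ Scheme.IsRegular (Spec (CommRingCat.of (MvPolynomial (Fin 2 ⊕ Fin 2) k ⧸ Ideal.span
      {(MvPolynomial.X (Sum.inl 0) * MvPolynomial.X (Sum.inl 1) +
        MvPolynomial.rename Sum.inr (MvPolynomial.X 0 * MvPolynomial.X 1) :
          MvPolynomial (Fin 2 ⊕ Fin 2) k)}))) ∧
    Scheme.HasResolution (Spec (CommRingCat.of (MvPolynomial (Fin 2 ⊕ Fin 2) k ⧸ Ideal.span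
      {(MvPolynomial.X (Sum.inl 0) * MvPolynomial.X (Sum.inl 1) +
        MvPolynomial.rename Sum.inr (MvPolynomial.X 0 * MvPolynomial.X 1) :
          MvPolynomial (Fin 2 ⊕ Fin 2) k)})))) ∧
    (¬ Scheme.IsRegular (Spec (CommRingCat.of (MvPolynomial (Fin 2 ⊕ Fin 1) k ⧸ Ideal.span
      {(MvPolynomial.X (Sum.inl 0) * MvPolynomial.X (Sum.inl 1) +
        MvPolynomial.rename Sum.inr (MvPolynomial.X 0 ^ 3) : MvPolynomial (Fin 2 ⊕ Fin 1) k)}))) ∧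
    Scheme.HasResolution (Spec (CommRingCat.of (MvPolynomial (Fin 2 ⊕ Fin 1) k ⧸ Ideal.span
      {(MvPolynomial.X (Sum.inl 0) * MvPolynomial.X (Sum.inl 1) +
        MvPolynomial.rename Sum.inr (MvPolynomial.X 0 ^ 3) : MvPolynomial (Fin 2 ⊕ Fin 1) k)})))) :=
  ⟨Theorems.FRationalResolution.quadricCone_singular_hasResolution k p,
    Theorems.FRationalResolution.coneProd_singular_hasResolution k p,
    Theorems.FRationalResolution.coneCube_singular_hasResolution k p⟩

/-! ## By-product stubs of continuation seat c2, wave 3: THE SINGULAR LOCUS OF `Σf` IS EXACTLY `Sing V(f) × {y = z = 0}`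

Calibration note, Claim B, as a theorem: at a prime `P ∋ y, z` of `k[y,z,x]` the local ring of
`Σf = {yz + f = 0}` is regular iff the local ring of the hypersurface `V(f) ⊂ 𝔸ⁿ` at `𝔮 = P ∩ k[x]` is
(and at primes missing `y` or `z`, `Σf` is regular). The stubs: the Jacobian-free criterion
"`S_P/(g)` regular iff `g ∉ P⁽²⁾`" for `S_P` regular (both directions are in the tree after wave 1:
`IsRegularLocalRing.quotient_span_singleton`, `not_isRegularLocalRing_quotient_of_mem_sq`), and the
transfer of `g ∈ P⁽²⁾` to `f ∈ 𝔮⁽²⁾` along `y, z ↦ 0` in `A[y,z]`. -/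

/-- STUB (worker V1) — LANDED p137264 (`Theorems/FrobeniusLadderFRationalResolutionRegularQuotientIff.lean`) — A HYPERSURFACE IN A REGULAR AMBIENT IS REGULAR AT `P` IFF ITS EQUATION IS NOT IN
THE SYMBOLIC SQUARE `P⁽²⁾ = P²S_P ∩ S`. `S` a domain, `P` prime with `S_P` regular local, `0 ≠ g ∈ P`:
`S_P/(g)` is a regular local ring iff there is no `u ∉ P` with `u g ∈ P²`. (⇐: `g/1 ∉ (P S_P)²`
— `IsLocalization.mem_map_algebraMap_iff`, `Ideal.map_pow`, `Localization.AtPrime.map_eq_maximalIdeal` —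
and `IsRegularLocalRing.quotient_span_singleton`; ⇒: if `u g ∈ P²` then `g/1 ∈ 𝔪²`, `g/1 ≠ 0`, and
`not_isRegularLocalRing_quotient_of_mem_sq` (Theorems/…SuspensionNotRegular.lean, p133997).) -/
theorem stub_isRegularLocalRing_quotient_iff (S : Type) [CommRing S] [IsDomain S] (P : Ideal S)
    [P.IsPrime] [IsRegularLocalRing (Localization.AtPrime P)] (g : S) (hg : g ∈ P) (hg0 : g ≠ 0) :
    IsRegularLocalRing (Localization.AtPrime P ⧸
        Ideal.span {algebraMap S (Localization.AtPrime P) g}) ↔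
      ¬ ∃ u : S, u ∉ P ∧ u * g ∈ P ^ 2 :=
  Theorems.FRationalResolution.stub_isRegularLocalRing_quotient_iff S P g hg hg0

/-- STUB (worker V2) — LANDED p137256 (`Theorems/FrobeniusLadderFRationalResolutionSqTransfer.lean`) — TRANSFER OF THE SYMBOLIC-SQUARE CONDITION ALONG `y, z ↦ 0`. In `A[y,z]`
(`y = X 0`, `z = X 1`, any commutative `A`), `P` a prime containing `y, z`, `𝔮 = P ∩ A` (the preimage
under `C`), `g = yz + f`: some `u ∉ P` has `u g ∈ P²` iff some `v ∉ 𝔮` has `v f ∈ 𝔮²`. (⇐: `C(𝔮²) ⊆ P²`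
and `yz ∈ P²`, `C v ∉ P`; ⇒: apply `constantCoeff` (`y, z ↦ 0`): it maps `P` onto `𝔮` — a polynomial
lies in `P ⊇ (y, z)` iff its constant coefficient lies in `𝔮`, `mem_iff_C_constantCoeff_mem` of
Theorems/…SuspensionBookkeeping.lean — hence `P²` into `𝔮²`, `u g ↦ u(0)·f`, and `u(0) ∉ 𝔮`.) -/
theorem stub_sq_transfer_constantCoeff (A : Type) [CommRing A] (f : A)
    (P : Ideal (MvPolynomial (Fin 2) A)) [P.IsPrime]
    (h0 : (MvPolynomial.X 0 : MvPolynomial (Fin 2) A) ∈ P)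
    (h1 : (MvPolynomial.X 1 : MvPolynomial (Fin 2) A) ∈ P) :
    (∃ u : MvPolynomial (Fin 2) A, u ∉ P ∧
        u * (MvPolynomial.X 0 * MvPolynomial.X 1 + MvPolynomial.C f) ∈ P ^ 2) ↔
      ∃ v : A, v ∉ P.comap (MvPolynomial.C : A →+* MvPolynomial (Fin 2) A) ∧
        v * f ∈ (P.comap (MvPolynomial.C : A →+* MvPolynomial (Fin 2) A)) ^ 2 :=
  Theorems.FRationalResolution.stub_sq_transfer_constantCoeff A f P h0 h1

/-! ### Assembly of wave 3 (lead; LANDED p137674 SuspensionSingularLocus): calibration Claim B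

`suspension_isRegularLocalRing_iff` (at `P ∋ y, z`: `Σf` regular at `P` iff `V(f)` regular at
`P ∩ k[x]`) and `suspension_isRegularLocalRing_of_notMem` (regular off `y = z = 0`): the residual class
member `Σf` carries EXACTLY the singularities of the hypersurface `V(f)`, two dimensions down. -/

/-- **CLAIM B (landed as `Theorems.FRationalResolution.suspension_isRegularLocalRing_iff`).** For every
field `k`, `f ≠ 0`, and prime `P ∋ y, z, yz + f` of `k[y,z,x₁..xₙ]`: the local ring of the suspension
`Σf` at `P` is regular iff the local ring of `V(f) ⊂ 𝔸ⁿ` at `P ∩ k[x]` is regular. -/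
theorem suspension_singularLocus (k : Type) [Field k] (n : ℕ) (f : MvPolynomial (Fin n) k) (hf : f ≠ 0)
    (P : Ideal (MvPolynomial (Fin 2 ⊕ Fin n) k)) [P.IsPrime]
    (hgP : (MvPolynomial.X (Sum.inl 0) * MvPolynomial.X (Sum.inl 1) + MvPolynomial.rename Sum.inr f :
      MvPolynomial (Fin 2 ⊕ Fin n) k) ∈ P)
    (h0 : (MvPolynomial.X (Sum.inl 0) : MvPolynomial (Fin 2 ⊕ Fin n) k) ∈ P)
    (h1 : (MvPolynomial.X (Sum.inl 1) : MvPolynomial (Fin 2 ⊕ Fin n) k) ∈ P) :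
    IsRegularLocalRing (Localization.AtPrime P ⧸ Ideal.span {algebraMap (MvPolynomial (Fin 2 ⊕ Fin n) k)
      (Localization.AtPrime P)
      (MvPolynomial.X (Sum.inl 0) * MvPolynomial.X (Sum.inl 1) + MvPolynomial.rename Sum.inr f)}) ↔
    IsRegularLocalRing (Localization.AtPrime (P.comap (MvPolynomial.rename Sum.inr :
        MvPolynomial (Fin n) k →ₐ[k] MvPolynomial (Fin 2 ⊕ Fin n) k)) ⧸
      Ideal.span {algebraMap (MvPolynomial (Fin n) k) (Localization.AtPrime (P.comap
        (MvPolynomial.rename Sum.inr : MvPolynomial (Fin n) k →ₐ[k] MvPolynomial (Fin 2 ⊕ Fin n) k))) f}) :=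
  Theorems.FRationalResolution.suspension_isRegularLocalRing_iff k n f hf P hgP h0 h1

/-! ## By-product stubs of continuation seat c3 (2026-08-17): RUNG 3½ ON THE GORENSTEIN SECTOR

Hochster–Huneke: an F-rational GORENSTEIN local ring is (weakly) F-regular [HochsterHuneke1994,
Thm. 4.2 / Cor. 4.7; FedderWatanabe1989 Prop. 2.2 (hypersurfaces); Huneke, *Tight closure and its
applications*, Thm. 4.2]. In the tree's vocabulary (no `Ext`, no injective hulls): for a Noetherian
local ring `(R, 𝔪)` of characteristic `p` whose parameter ideals `q` have CYCLIC SOCLE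
(`(q : 𝔪) = q + (t)`; true for every complete-intersection quotient `S/(g₁, …, g_c)`,
`c = dim S − dim R`, of a regular local ring `S` — the tree's `exists_colon_maximalIdeal_eq_sup_span`,
Matsumura 18.1), the crux's F-rational stalk clause (every parameter ideal tightly closed) implies
the weakly-F-regular clause (every ideal tightly closed). Hence on the hypersurface sector — which
by the c2 calibration (`Σf = {yz + f = 0}`) already carries every hypersurface singularity two
dimensions down — rung 3½ (`stub_weaklyFRegularModification`) holds with the IDENTITY as model and
the crux there IS rung 4′; the content of 3½ lives in the non-Gorenstein sector.

Engine: (i) cyclic socle ⇒ DOUBLE ANNIHILATOR `q : (q : J) = J` for `J ⊇ q` by a length count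
(`stub_doubleColon_of_socle_cyclic`, lead); (ii) colons of tightly closed ideals are tightly closed
(`stub_colon_tightlyClosed`); (iii) Krull's intersection theorem reduces the clause to `𝔪`-primary
ideals (`stub_clause_of_mPrimary`); (iv) every `𝔪`-primary ideal contains a parameter ideal, namely
the powers of one system of parameters (`stub_sop_le_of_mPrimary`); (v) parameter ideals of a
complete-intersection quotient of a regular local ring have cyclic socle (`stub_socle_cyclic_of_ci`).
Assembly: `weaklyFRegular_of_fRational_of_socle_cyclic` (ring level, abstract socle hypothesis) and
`weaklyFRegular_of_fRational_of_ci` (complete intersections). -/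

/-- STUB (lead, G1) — LANDED p139297 (`Theorems/FrobeniusLadderFRationalResolutionDoubleColonOfSocleCyclic.lean`) — DOUBLE ANNIHILATOR FROM A CYCLIC SOCLE. `(R, 𝔪)` Noetherian local, `q` an
`𝔪`-primary ideal (`𝔪^N ⊆ q`) whose socle is cyclic, `(q : 𝔪) = q + (t)`. Then every ideal
`J ⊇ q` satisfies `q : (q : J) = J`. Proof (lengths of `R/I`, `I ⊇ q`, all finite): one step
`J' = J + (a)`, `𝔪a ⊆ J` gives `(q : J)/(q : J') ↪ (q : 𝔪)/q` via `b ↦ ab`, a module killed by `𝔪`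
and cyclic, so of length `≤ 1`; along a composition chain, `ℓ(R/(q:J')) + ℓ(R/J') ≤ ℓ(R/(q:J)) + ℓ(R/J)`
for `q ⊆ J ⊆ J'`; the two ends `J = q` (value `ℓ(R/q)`) and `J' = R` (value `ℓ(R/q)`) squeeze
`ℓ(R/(q:J)) + ℓ(R/J) = ℓ(R/q)` for all `J ⊇ q`; apply it to `J` and to `q : J` and compare with
`J ⊆ q : (q : J)`. [Matsumura1987 Thm. 18.1 (5') ⇒ (4); BrunsHerzog1998 3.2.15 — here by counting] -/
theorem stub_doubleColon_of_socle_cyclic (R : Type) [CommRing R] [IsNoetherianRing R] [IsLocalRing R]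
    (q : Ideal R) (N : ℕ) (hN : IsLocalRing.maximalIdeal R ^ N ≤ q) (t : R)
    (hsoc : q.colon (IsLocalRing.maximalIdeal R : Set R) = q ⊔ Ideal.span {t})
    (J : Ideal R) (hJ : q ≤ J) :
    q.colon ((q.colon (J : Set R) : Ideal R) : Set R) = J :=
  Theorems.FRationalResolution.stub_doubleColon_of_socle_cyclic R q N hN t hsoc J hJ

/-- STUB (worker, G2) — LANDED p139077 (`Theorems/FrobeniusLadderFRationalResolutionColonTightlyClosed.lean`) — COLONS OF TIGHTLY CLOSED IDEALS ARE TIGHTLY CLOSED (inline clause, any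
commutative ring, any `p`): if `I` satisfies "`c ≠ 0 ∧ (∀ e, c·y^(p^e) ∈ ({z^(p^e) | z ∈ I})) ⇒ y ∈ I`"
then so does `I : K` for every set `K` (for `k ∈ K` and `z ∈ (I : K)`, `z^q k^q = (zk)^q` with
`zk ∈ I`, so `c (yk)^q ∈ ({z^q | z ∈ I})` and `yk ∈ I`). [HochsterHuneke1990 Prop. 4.1 (m); folklore] -/
theorem stub_colon_tightlyClosed (p : ℕ) (R : Type) [CommRing R] (I : Ideal R) (K : Set R)
    (hI : ∀ y c : R, c ≠ 0 →
      (∀ e : ℕ, c * y ^ p ^ e ∈ Ideal.span ((fun z : R => z ^ p ^ e) '' (I : Set R))) → y ∈ I) :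
    ∀ y c : R, c ≠ 0 →
      (∀ e : ℕ, c * y ^ p ^ e ∈ Ideal.span ((fun z : R => z ^ p ^ e) '' (I.colon K : Set R))) →
      y ∈ I.colon K :=
  Theorems.FRationalResolution.stub_colon_tightlyClosed p R I K hI

/-- STUB (worker, G3) — LANDED p139081 (`Theorems/FrobeniusLadderFRationalResolutionClauseOfMPrimary.lean`) — REDUCTION TO `𝔪`-PRIMARY IDEALS (Krull's intersection theorem). In a
Noetherian local ring `(R, 𝔪)`, if every ideal containing a power of `𝔪` satisfies the inline
tight-closure clause, then every ideal does: `c·y^q ∈ I^[q] ⊆ (I + 𝔪^N)^[q]` puts `y` in every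
`I + 𝔪^N`, and `⋂_N (I + 𝔪^N) = I` (Krull, applied to `R/I`). [Matsumura1987 Thm. 8.10; folklore] -/
theorem stub_clause_of_mPrimary (p : ℕ) (R : Type) [CommRing R] [IsNoetherianRing R] [IsLocalRing R]
    (h : ∀ I : Ideal R, (∃ N : ℕ, IsLocalRing.maximalIdeal R ^ N ≤ I) → ∀ y c : R, c ≠ 0 →
      (∀ e : ℕ, c * y ^ p ^ e ∈ Ideal.span ((fun z : R => z ^ p ^ e) '' (I : Set R))) → y ∈ I)
    (I : Ideal R) (y c : R) (hc : c ≠ 0)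
    (hy : ∀ e : ℕ, c * y ^ p ^ e ∈ Ideal.span ((fun z : R => z ^ p ^ e) '' (I : Set R))) :
    y ∈ I :=
  Theorems.FRationalResolution.stub_clause_of_mPrimary p R h I y c hc hy

/-- STUB (worker, G4) — LANDED p139156 (`Theorems/FrobeniusLadderFRationalResolutionSopLeOfMPrimary.lean`) — EVERY `𝔪`-PRIMARY IDEAL CONTAINS A PARAMETER IDEAL. In a Noetherian local
ring `(R, 𝔪)` of dimension `d`, for every ideal `I ⊇ 𝔪^N` there are `d` elements `s` generating an
ideal with maximal radical (a system of parameters), contained in `I`, and containing a power of `𝔪`: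
take any system of parameters `s₀` (`exists_isSystemOfParameters`, in the tree) and `s = s₀^N`
(`rad (s₀^N) = rad (s₀) = 𝔪`; `𝔪` is finitely generated). [Matsumura1987 Thm. 14.1; folklore] -/
theorem stub_sop_le_of_mPrimary (R : Type) [CommRing R] [IsNoetherianRing R] [IsLocalRing R]
    (d : ℕ) (hd : ringKrullDim R = d) (I : Ideal R) (N : ℕ)
    (hN : IsLocalRing.maximalIdeal R ^ N ≤ I) :
    ∃ s : Fin d → R, (Ideal.span (Set.range s)).radical.IsMaximal ∧ Ideal.span (Set.range s) ≤ I ∧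
      ∃ M : ℕ, IsLocalRing.maximalIdeal R ^ M ≤ Ideal.span (Set.range s) :=
  Theorems.FRationalResolution.stub_sop_le_of_mPrimary R d hd I N hN

/-- STUB (worker, G5) — LANDED p139167 (`Theorems/FrobeniusLadderFRationalResolutionSocleCyclicOfCI.lean`) — PARAMETER IDEALS OF A COMPLETE-INTERSECTION QUOTIENT OF A REGULAR LOCAL RING
HAVE CYCLIC SOCLE. `S` regular local, `f : S ↠ R` surjective onto a local ring with kernel generated
by a list `G`, and `G.length + d = dim S`. Then for every `d` elements `s` of `R` generating an ideal
with maximal radical there is `t` with `((s) : 𝔪_R) = (s) + (t)`. Proof: lift `s` to `s̃ ⊆ S`; the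
`dim S` elements `G ++ s̃` lie in `𝔪_S` and generate `f⁻¹ (s) ⊇ 𝔪_S^N` (as `(s) ⊇ 𝔪_R^N`, `R`
Noetherian), so the socle of `S/(G, s̃)` is cyclic (`exists_colon_maximalIdeal_eq_sup_span`,
Literature/RingTheory/RegularLocalRing/ParameterIdealSocle.lean); colons by `𝔪` correspond under `f`
for ideals containing `ker f` (`f(𝔪_S) = 𝔪_R`). [Matsumura1987 Thm. 18.1 with 21.3; folklore] -/
theorem stub_socle_cyclic_of_ci (S R : Type) [CommRing S] [IsRegularLocalRing S] [CommRing R]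
    [IsLocalRing R] (f : S →+* R) (hf : Function.Surjective f) (G : List S)
    (hker : RingHom.ker f = Ideal.ofList G) (d : ℕ)
    (hdim : ((G.length + d : ℕ) : WithBot ℕ∞) = ringKrullDim S)
    (s : Fin d → R) (hs : (Ideal.span (Set.range s)).radical.IsMaximal) :
    ∃ t : R, (Ideal.span (Set.range s)).colon (IsLocalRing.maximalIdeal R : Set R) =
      Ideal.span (Set.range s) ⊔ Ideal.span {t} :=
  Theorems.FRationalResolution.stub_socle_cyclic_of_ci S R f hf G hker d hdim s hs

/-- STUB (worker, G6) — LANDED p139176 (`Theorems/FrobeniusLadderFRationalResolutionHypersurfaceQuotientData.lean`) — HYPERSURFACE QUOTIENT DATA. For a regular local ring `S` and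
`0 ≠ g ∈ 𝔪_S`: the quotient `S/(g)` is non-trivial, the kernel of `S → S/(g)` is the ideal of the
one-element list `[g]`, and `dim S/(g)` is a natural number `d` with `1 + d = dim S` (a regular local
ring is a domain, so `g` is `S`-regular and the dimension drops by exactly one:
`ringKrullDim_quotient_span_singleton_succ_eq_ringKrullDim`-type lemma of the tree / Mathlib's
`ringKrullDim_quotient_span_singleton_succ_eq_ringKrullDim_of_mem_nonZeroDivisors`). This is the
input of `stub_socle_cyclic_of_ci` for hypersurface local rings. [Matsumura1987 Thm. 17.4/14.3; folklore] -/
theorem stub_hypersurface_quotient_data (S : Type) [CommRing S] [IsRegularLocalRing S] (g : S)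
    (hg : g ∈ IsLocalRing.maximalIdeal S) (hg0 : g ≠ 0) :
    Nontrivial (S ⧸ Ideal.span {g}) ∧
    RingHom.ker (Ideal.Quotient.mk (Ideal.span {g})) = Ideal.ofList [g] ∧
    ∃ d : ℕ, ringKrullDim (S ⧸ Ideal.span {g}) = d ∧
      ((([g].length + d : ℕ) : WithBot ℕ∞) = ringKrullDim S) :=
  Theorems.FRationalResolution.stub_hypersurface_quotient_data S g hg hg0

/-! ### Assembly of the c3 stubs (lead): F-rational ⇒ weakly F-regular on the Gorenstein sector -/

/-- **F-RATIONAL ⇒ WEAKLY F-REGULAR WHEN PARAMETER IDEALS HAVE CYCLIC SOCLE** (Hochster–Huneke's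
"F-rational Gorenstein rings are F-regular", ring level, inline clauses). `(R, 𝔪)` Noetherian local of
prime characteristic `p`; if every ideal generated by a system of parameters (`dim R` elements, maximal
radical) is tightly closed in the crux's inline sense AND has cyclic socle, then EVERY ideal of `R` is
tightly closed in the inline sense. (Krull reduction to `𝔪`-primary `I`; a parameter ideal `q ⊆ I`;
`q : (q : I) = I` by the double annihilator; colons of the tightly closed `q` are tightly closed.) -/
theorem weaklyFRegular_of_fRational_of_socle_cyclic (p : ℕ) (R : Type) [CommRing R]
    [IsNoetherianRing R] [IsLocalRing R]
    (hFR : ∀ d : ℕ, ringKrullDim R = d → ∀ s : Fin d → R,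
      (Ideal.span (Set.range s)).radical.IsMaximal → ∀ y c : R, c ≠ 0 →
      (∀ e : ℕ, c * y ^ p ^ e ∈ Ideal.span ((fun z : R => z ^ p ^ e) ''
        (Ideal.span (Set.range s) : Set R))) → y ∈ Ideal.span (Set.range s))
    (hsoc : ∀ d : ℕ, ringKrullDim R = d → ∀ s : Fin d → R,
      (Ideal.span (Set.range s)).radical.IsMaximal →
      ∃ t : R, (Ideal.span (Set.range s)).colon (IsLocalRing.maximalIdeal R : Set R) =
        Ideal.span (Set.range s) ⊔ Ideal.span {t})
    (I : Ideal R) (y c : R) (hc : c ≠ 0)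
    (hy : ∀ e : ℕ, c * y ^ p ^ e ∈ Ideal.span ((fun z : R => z ^ p ^ e) '' (I : Set R))) :
    y ∈ I := by
  refine stub_clause_of_mPrimary p R (fun I hI y c hc hy => ?_) I y c hc hy
  obtain ⟨N, hN⟩ := hI
  obtain ⟨d, hd⟩ : ∃ d : ℕ, ringKrullDim R = d :=
    Literature.RingTheory.TightClosure.exists_ringKrullDim_eq_nat
  obtain ⟨s, hsmax, hsI, M, hM⟩ := stub_sop_le_of_mPrimary R d hd I N hN
  obtain ⟨t, ht⟩ := hsoc d hd s hsmax
  have hqI := stub_doubleColon_of_socle_cyclic R (Ideal.span (Set.range s)) M hM t ht I hsI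
  rw [← hqI]
  refine stub_colon_tightlyClosed p R (Ideal.span (Set.range s)) _ (hFR d hd s hsmax) y c hc ?_
  rw [hqI]
  exact hy

/-- **F-RATIONAL ⇒ WEAKLY F-REGULAR FOR COMPLETE INTERSECTIONS** (rung 3½ with the identity model on
the Gorenstein sector, ring level): if `R` is a local quotient of a regular local ring `S` by
`c = dim S − dim R` equations and every parameter ideal of `R` is tightly closed (inline clause), then
every ideal of `R` is tightly closed (inline clause). In particular HYPERSURFACE local rings
`S/(g)` — among them every stalk of the calibration family `Σf` and of every hypersurface of affine
space — are F-rational iff weakly F-regular. -/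
theorem weaklyFRegular_of_fRational_of_ci (p : ℕ) (S R : Type) [CommRing S] [IsRegularLocalRing S]
    [CommRing R] [IsNoetherianRing R] [IsLocalRing R] (f : S →+* R) (hf : Function.Surjective f)
    (G : List S) (hker : RingHom.ker f = Ideal.ofList G) (d : ℕ) (hd : ringKrullDim R = d)
    (hdim : ((G.length + d : ℕ) : WithBot ℕ∞) = ringKrullDim S)
    (hFR : ∀ d : ℕ, ringKrullDim R = d → ∀ s : Fin d → R,
      (Ideal.span (Set.range s)).radical.IsMaximal → ∀ y c : R, c ≠ 0 →
      (∀ e : ℕ, c * y ^ p ^ e ∈ Ideal.span ((fun z : R => z ^ p ^ e) ''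
        (Ideal.span (Set.range s) : Set R))) → y ∈ Ideal.span (Set.range s))
    (I : Ideal R) (y c : R) (hc : c ≠ 0)
    (hy : ∀ e : ℕ, c * y ^ p ^ e ∈ Ideal.span ((fun z : R => z ^ p ^ e) '' (I : Set R))) :
    y ∈ I := by
  refine weaklyFRegular_of_fRational_of_socle_cyclic p R hFR (fun d' hd' s hs => ?_) I y c hc hy
  have hdd : d' = d := by
    have h := hd'.symm.trans hd
    exact_mod_cast h
  subst hdd
  exact stub_socle_cyclic_of_ci S R f hf G hker d' hdim s hs

/-- **HYPERSURFACE LOCAL RINGS: F-RATIONAL ⇒ WEAKLY F-REGULAR** (Fedder–Watanabe 1989 Prop. 2.2 /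
Hochster–Huneke 1994 for Gorenstein rings, the hypersurface case, inline clauses): for a regular
local ring `S` and `0 ≠ g ∈ 𝔪_S`, if every parameter ideal of `S/(g)` is tightly closed then every
ideal of `S/(g)` is tightly closed. Every stalk of the calibration family `Σf` (c2) and of every
hypersurface in a smooth `k`-variety has this shape; on that sector rung 3½ costs nothing. -/
theorem weaklyFRegular_of_fRational_hypersurface (p : ℕ) (S : Type) [CommRing S]
    [IsRegularLocalRing S] (g : S) (hg : g ∈ IsLocalRing.maximalIdeal S) (hg0 : g ≠ 0)
    (hFR : ∀ d : ℕ, ringKrullDim (S ⧸ Ideal.span {g}) = d → ∀ s : Fin d → S ⧸ Ideal.span {g},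
      (Ideal.span (Set.range s)).radical.IsMaximal → ∀ y c : S ⧸ Ideal.span {g}, c ≠ 0 →
      (∀ e : ℕ, c * y ^ p ^ e ∈ Ideal.span ((fun z : S ⧸ Ideal.span {g} => z ^ p ^ e) ''
        (Ideal.span (Set.range s) : Set (S ⧸ Ideal.span {g})))) → y ∈ Ideal.span (Set.range s))
    (I : Ideal (S ⧸ Ideal.span {g})) (y c : S ⧸ Ideal.span {g}) (hc : c ≠ 0)
    (hy : ∀ e : ℕ, c * y ^ p ^ e ∈
      Ideal.span ((fun z : S ⧸ Ideal.span {g} => z ^ p ^ e) '' (I : Set (S ⧸ Ideal.span {g})))) :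
    y ∈ I := by
  obtain ⟨hnt, hker, d, hd, hdim⟩ := stub_hypersurface_quotient_data S g hg hg0
  haveI := hnt
  haveI : IsLocalRing (S ⧸ Ideal.span {g}) := .of_surjective' _ Ideal.Quotient.mk_surjective
  exact weaklyFRegular_of_fRational_of_ci p S (S ⧸ Ideal.span {g}) (Ideal.Quotient.mk _)
    Ideal.Quotient.mk_surjective [g] hker d hd hdim hFR I y c hc hy

/-! ### Scheme form (lead): rung 3½ holds with the identity model on hypersurfaces in regular ambients -/

/-- **F-RATIONAL STALKS OF A HYPERSURFACE ARE WEAKLY F-REGULAR.** Let `S` be a regular domain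
(e.g. `k[x₁, …, xₙ]`), `0 ≠ g ∈ S` and `X = Spec (S ⧸ (g))`. If the stalk `𝒪_{X,x}` satisfies the
crux's F-rational clause (domain, every parameter ideal tightly closed), then EVERY ideal of `𝒪_{X,x}`
is tightly closed (the weakly-F-regular clause of rungs 3½/4′): `𝒪_{X,x} ≅ S_P ⧸ (g)` for `P` the
preimage of `x` (`nonempty_stalk_ringEquiv_localization_quotient`, W6), `S_P` is regular local, and
`weaklyFRegular_of_fRational_hypersurface` applies; both clauses transport along ring isomorphisms. -/
theorem weaklyFRegular_stalk_hypersurface_of_fRational (p : ℕ) (S : Type) [CommRing S] [IsDomain S]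
    [IsRegularRing S] (g : S) (hg0 : g ≠ 0) (x : Spec (CommRingCat.of (S ⧸ Ideal.span {g})))
    (hFR : IsDomain ((Spec (CommRingCat.of (S ⧸ Ideal.span {g}))).presheaf.stalk x) ∧
      ∀ d : ℕ, ringKrullDim ((Spec (CommRingCat.of (S ⧸ Ideal.span {g}))).presheaf.stalk x) = d →
      ∀ s : Fin d → (Spec (CommRingCat.of (S ⧸ Ideal.span {g}))).presheaf.stalk x,
      (Ideal.span (Set.range s)).radical.IsMaximal →
      ∀ y c : (Spec (CommRingCat.of (S ⧸ Ideal.span {g}))).presheaf.stalk x, c ≠ 0 →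
      (∀ e : ℕ, c * y ^ p ^ e ∈ Ideal.span
        ((fun z : (Spec (CommRingCat.of (S ⧸ Ideal.span {g}))).presheaf.stalk x => z ^ p ^ e) ''
          (Ideal.span (Set.range s) :
            Set ((Spec (CommRingCat.of (S ⧸ Ideal.span {g}))).presheaf.stalk x)))) →
      y ∈ Ideal.span (Set.range s)) :
    IsDomain ((Spec (CommRingCat.of (S ⧸ Ideal.span {g}))).presheaf.stalk x) ∧
      ∀ (I : Ideal ((Spec (CommRingCat.of (S ⧸ Ideal.span {g}))).presheaf.stalk x))
        (y c : (Spec (CommRingCat.of (S ⧸ Ideal.span {g}))).presheaf.stalk x), c ≠ 0 →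
        (∀ e : ℕ, c * y ^ p ^ e ∈ Ideal.span
          ((fun z : (Spec (CommRingCat.of (S ⧸ Ideal.span {g}))).presheaf.stalk x => z ^ p ^ e) ''
            (I : Set ((Spec (CommRingCat.of (S ⧸ Ideal.span {g}))).presheaf.stalk x)))) →
        y ∈ I := by
  set P : Ideal S := x.asIdeal.comap (Ideal.Quotient.mk (Ideal.span {g})) with hP
  haveI hPprime : P.IsPrime := Ideal.comap_isPrime _ _
  obtain ⟨e⟩ :=
    Theorems.FRationalResolution.nonempty_stalk_ringEquiv_localization_quotient S g x P rfl
  have hgP : g ∈ P := by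
    rw [hP, Ideal.mem_comap, Ideal.Quotient.eq_zero_iff_mem.mpr (Ideal.mem_span_singleton_self g)]
    exact zero_mem _
  have hg' : algebraMap S (Localization.AtPrime P) g ∈
      IsLocalRing.maximalIdeal (Localization.AtPrime P) := by
    rw [← Localization.AtPrime.map_eq_maximalIdeal]
    exact Ideal.mem_map_of_mem _ hgP
  have hg'0 : algebraMap S (Localization.AtPrime P) g ≠ 0 := fun h => hg0 <|
    (IsLocalization.injective (Localization.AtPrime P) P.primeCompl_le_nonZeroDivisors)
      (h.trans (map_zero _).symm)
  have hFR' := Theorems.FRationalResolution.ClauseInvariance.stub_clause_of_ringEquiv p e hFR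
  refine ⟨hFR.1, Theorems.FRationalResolution.allIdeals_clause_of_ringEquiv p e ?_⟩
  intro I y c hc hy
  exact weaklyFRegular_of_fRational_hypersurface p (Localization.AtPrime P)
    (algebraMap S (Localization.AtPrime P) g) hg' hg'0 hFR'.2 I y c hc hy

/-- **RUNG 3½ ON THE HYPERSURFACE SECTOR (scheme form).** For a regular domain `S`, `0 ≠ g ∈ S` and
`X = Spec (S ⧸ (g))` all of whose stalks satisfy the F-rational clause, `X` is ITS OWN weakly F-regular
proper birational model: the conclusion of `stub_weaklyFRegularModification` holds with `π = 𝟙 X`.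
By the c2 calibration this sector (the suspensions `Σf`, `S = k[y, z, x]`, `g = yz + f`) already
carries every hypersurface singularity two dimensions down; there the crux IS rung 4′. -/
theorem rung3half_hypersurface (p : ℕ) (S : Type) [CommRing S] [IsDomain S] [IsRegularRing S]
    (g : S) (hg0 : g ≠ 0)
    (hFR : ∀ x : Spec (CommRingCat.of (S ⧸ Ideal.span {g})),
      IsDomain ((Spec (CommRingCat.of (S ⧸ Ideal.span {g}))).presheaf.stalk x) ∧
      ∀ d : ℕ, ringKrullDim ((Spec (CommRingCat.of (S ⧸ Ideal.span {g}))).presheaf.stalk x) = d →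
      ∀ s : Fin d → (Spec (CommRingCat.of (S ⧸ Ideal.span {g}))).presheaf.stalk x,
      (Ideal.span (Set.range s)).radical.IsMaximal →
      ∀ y c : (Spec (CommRingCat.of (S ⧸ Ideal.span {g}))).presheaf.stalk x, c ≠ 0 →
      (∀ e : ℕ, c * y ^ p ^ e ∈ Ideal.span
        ((fun z : (Spec (CommRingCat.of (S ⧸ Ideal.span {g}))).presheaf.stalk x => z ^ p ^ e) ''
          (Ideal.span (Set.range s) :
            Set ((Spec (CommRingCat.of (S ⧸ Ideal.span {g}))).presheaf.stalk x)))) →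
      y ∈ Ideal.span (Set.range s)) :
    ∃ (X' : Scheme.{0}) (π : X' ⟶ Spec (CommRingCat.of (S ⧸ Ideal.span {g}))),
      IsProper π ∧ IsBirational π ∧
      ∀ x : X', IsDomain (X'.presheaf.stalk x) ∧ ∀ I : Ideal (X'.presheaf.stalk x),
        ∀ y c : X'.presheaf.stalk x, c ≠ 0 →
        (∀ e : ℕ, c * y ^ p ^ e ∈ Ideal.span ((fun z : X'.presheaf.stalk x => z ^ p ^ e) ''
          (I : Set (X'.presheaf.stalk x)))) → y ∈ I := by
  refine ⟨_, 𝟙 _, inferInstance, ⟨⊤, ?_, ?_, ?_⟩,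
    fun x => weaklyFRegular_stalk_hypersurface_of_fRational p S g hg0 x (hFR x)⟩
  · simp
  · simp
  · infer_instance

/-- **ON HYPERSURFACES THE CRUX IS RUNG 4′ ALONE.** For a field `k` of characteristic `p`, a regular
`k`-domain `S` of finite type presented so that `X = Spec (S ⧸ (g)) → Spec k` is separated, locally of
finite type and quasi-compact, and `0 ≠ g ∈ S`: if every stalk of `X` satisfies the F-rational clause
then `X` has a resolution of singularities AS SOON AS rung 4′ (`stub_weaklyFRegularResolution`) holds —
rung 3½ is discharged by `weaklyFRegular_stalk_hypersurface_of_fRational`. -/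
theorem hypersurfaceCore_of_rung4 (p : ℕ) (hp : p.Prime) (k : Type) [Field k] [CharP k p]
    (S : Type) [CommRing S] [IsDomain S] [IsRegularRing S] (g : S) (hg0 : g ≠ 0)
    (f : Spec (CommRingCat.of (S ⧸ Ideal.span {g})) ⟶ Spec (.of k)) [IsSeparated f]
    [LocallyOfFiniteType f] [QuasiCompact f]
    (hFR : ∀ x : Spec (CommRingCat.of (S ⧸ Ideal.span {g})),
      IsDomain ((Spec (CommRingCat.of (S ⧸ Ideal.span {g}))).presheaf.stalk x) ∧
      ∀ d : ℕ, ringKrullDim ((Spec (CommRingCat.of (S ⧸ Ideal.span {g}))).presheaf.stalk x) = d →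
      ∀ s : Fin d → (Spec (CommRingCat.of (S ⧸ Ideal.span {g}))).presheaf.stalk x,
      (Ideal.span (Set.range s)).radical.IsMaximal →
      ∀ y c : (Spec (CommRingCat.of (S ⧸ Ideal.span {g}))).presheaf.stalk x, c ≠ 0 →
      (∀ e : ℕ, c * y ^ p ^ e ∈ Ideal.span
        ((fun z : (Spec (CommRingCat.of (S ⧸ Ideal.span {g}))).presheaf.stalk x => z ^ p ^ e) ''
          (Ideal.span (Set.range s) :
            Set ((Spec (CommRingCat.of (S ⧸ Ideal.span {g}))).presheaf.stalk x)))) →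
      y ∈ Ideal.span (Set.range s)) :
    Scheme.HasResolution (Spec (CommRingCat.of (S ⧸ Ideal.span {g}))) :=
  stub_weaklyFRegularResolution p hp k _ f fun x =>
    weaklyFRegular_stalk_hypersurface_of_fRational p S g hg0 x (hFR x)

/-! ## By-product stubs of continuation seat c3, wave 2: the GORENSTEIN form of the sector theorem,
and step lemmas of the `A_m` programme for rung 4′

(1) From complete intersections to GORENSTEIN (= Cohen–Macaulay of type 1) in the tree's vocabulary:
in a Noetherian local ring all of whose systems of parameters are (weakly) regular sequences, the
cyclicity of the socle of `R/q` does not depend on the parameter ideal `q` (the type is an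
invariant; `stub_socle_cyclic_of_one`, generalising the exchange chain of
`Literature/RingTheory/RegularLocalRing/ParameterIdealSocle.lean` from regular to Cohen–Macaulay).
With "F-rational ⇒ Cohen–Macaulay" (c1, `isWeaklyRegular_of_fRational_clause_quotient`) this gives
Hochster–Huneke's theorem in its natural form: an F-rational local ring `S/Q` (S regular) with ONE
irreducible parameter ideal is weakly F-regular (`weaklyFRegular_of_fRational_gorenstein`, lead).
(2) Towards rung 4′ on the whole `A_m` family `{yz + x^(m+1) = 0}` by the tower of point blow-ups:
the graph charts of the blow-up of the origin are affine planes for every exponent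
(`stub_chart_graph_pow`), the elimination chart is the `A_{m−2}` surface (`stub_chart_elim_pow`),
and resolutions glue into a regular open along an isomorphism (`stub_hasResolution_glue`, the open
gluing infrastructure asked for by the c2 report; Mathlib has push-outs of open immersions as
colimits of locally directed diagrams). -/

/-- STUB (worker, S1) — THE TYPE OF A COHEN–MACAULAY LOCAL RING IS AN INVARIANT (cyclic-socle form).
`(R, 𝔪)` Noetherian local such that every list of `dim R` elements of `𝔪` generating an
`𝔪`-primary ideal is a weakly regular sequence (e.g. `R` Cohen–Macaulay). If ONE such parameter
ideal `(Q₁)` has cyclic socle `((Q₁) : 𝔪) = (Q₁) + (t₁)`, then EVERY parameter ideal `(Q₂)` has.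
Proof: the exchange chain of `ParameterIdealSocle.lean` (`exists_exchange`,
`colon_cyclic_iff_exchange`, `colon_cyclic_iff_of_append`) with the regularity of the exchanged
member modulo the retained ones (`mem_of_mul_mem_of_sop` there, from `IsRegularLocalRing`) now read
off the hypothesis `hCM` (`RingTheory.Sequence.isWeaklyRegular_append_iff` /
`isWeaklyRegular_cons_iff`); `SocleExchange.lean` is already stated for Noetherian local rings.
[BrunsHerzog1998 Lemma 1.2.4 / 1.2.19; Matsumura1987 Thm. 18.1] -/
theorem stub_socle_cyclic_of_one (R : Type) [CommRing R] [IsNoetherianRing R] [IsLocalRing R]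
    (hCM : ∀ Q : List R, (Q.length : WithBot ℕ∞) = ringKrullDim R →
      (∀ q ∈ Q, q ∈ IsLocalRing.maximalIdeal R) →
      (∃ N : ℕ, IsLocalRing.maximalIdeal R ^ N ≤ Ideal.ofList Q) →
      RingTheory.Sequence.IsWeaklyRegular R Q)
    (Q₁ Q₂ : List R) (h₁ : (Q₁.length : WithBot ℕ∞) = ringKrullDim R)
    (h₂ : (Q₂.length : WithBot ℕ∞) = ringKrullDim R)
    (hm₁ : ∀ q ∈ Q₁, q ∈ IsLocalRing.maximalIdeal R) (hm₂ : ∀ q ∈ Q₂, q ∈ IsLocalRing.maximalIdeal R)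
    (N₁ N₂ : ℕ) (hN₁ : IsLocalRing.maximalIdeal R ^ N₁ ≤ Ideal.ofList Q₁)
    (hN₂ : IsLocalRing.maximalIdeal R ^ N₂ ≤ Ideal.ofList Q₂) (t₁ : R)
    (hsoc : (Ideal.ofList Q₁).colon (IsLocalRing.maximalIdeal R : Set R) =
      Ideal.ofList Q₁ ⊔ Ideal.span {t₁}) :
    ∃ t₂ : R, (Ideal.ofList Q₂).colon (IsLocalRing.maximalIdeal R : Set R) =
      Ideal.ofList Q₂ ⊔ Ideal.span {t₂} :=
  -- LANDED p140016 (`Theorems/FrobeniusLadderFRationalResolutionSocleCyclicOfOne.lean`)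
  Summit.ResolutionOfSingularities.ResolutionOfSingularities.Theorems.FRationalResolution.stub_socle_cyclic_of_one R hCM Q₁ Q₂ h₁ h₂ hm₁ hm₂ N₁ N₂
    hN₁ hN₂ t₁ hsoc

/-- STUB (worker, T2) — GRAPH CHART OF THE BLOW-UP OF `A_m` AT THE ORIGIN, EVERY EXPONENT. `R` a
`k`-algebra generated by `x, y, z` with `yz + x^(n+1) = 0` (`n ≥ 1`) and a test map
`θ : R → k[Y, X'][1/Y]`, `θ y = Y`, `θ x = X'Y`, `θ z = −X'^(n+1) Y^n`. Then the affine blowup algebra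
`R[I/y]`, `I = (x, y, z)`, is a regular ring — `k[Y, X'] → R[I/y]`, `Y ↦ y`, `X' ↦ x/y` is an
isomorphism (`z/y = −(x/y)^(n+1) y^(n−1)`; surjective by `hgen`, injective through `θ` extended to
`R[1/y]`, exactly as `stub_chart_graph_cube`, the case `n = 2`, file
`Theorems/FrobeniusLadderFRationalResolutionChartGraphCube.lean`). [Hartshorne II.7 / Stacks 052P; folklore] -/
theorem stub_chart_graph_pow (k R : Type) [Field k] [CommRing R] [Algebra k R] (n : ℕ) (hn : 1 ≤ n)
    (x y z : R) (hrel : y * z + x ^ (n + 1) = 0) (hgen : Algebra.adjoin k {x, y, z} = ⊤)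
    (θ : R →ₐ[k] Localization.Away (MvPolynomial.X 0 : MvPolynomial (Fin 2) k))
    (hθy : θ y = algebraMap (MvPolynomial (Fin 2) k) _ (MvPolynomial.X 0))
    (hθx : θ x = algebraMap (MvPolynomial (Fin 2) k) _ (MvPolynomial.X 1 * MvPolynomial.X 0))
    (hθz : θ z = -(algebraMap (MvPolynomial (Fin 2) k) _
      (MvPolynomial.X 1 ^ (n + 1) * MvPolynomial.X 0 ^ n))) :
    IsRegularRing (blowupAlgebra (Ideal.span {x, y, z}) y) :=
  -- LANDED p140034 (`Theorems/FrobeniusLadderFRationalResolutionChartGraphPow.lean`)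
  Summit.ResolutionOfSingularities.ResolutionOfSingularities.Theorems.FRationalResolution.stub_chart_graph_pow k R n hn x y z hrel hgen θ hθy hθx hθz

/-- STUB (worker, T1) — ELIMINATION CHART OF THE BLOW-UP OF `A_m` AT THE ORIGIN IS `A_{m−2}`. `R` a
`k`-algebra generated by `x, y, z` with `yz + x^(e+2) = 0`, and a test map `θ : R → Rₑ[1/c̄]` into
the localization of the SMALLER suspension ring `Rₑ = k[a, b, c]/(ab + c^e)` (presented as
`MvPolynomial (Fin 2 ⊕ Fin 1) k ⧸ (X(inl 0) X(inl 1) + X(inr 0)^e)`, the c2 convention) with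
`θ x = c̄`, `θ y = ā c̄`, `θ z = b̄ c̄`. Then the `k`-algebra map `Rₑ → R[1/x]`, `ā ↦ y/x`, `b̄ ↦ z/x`,
`c̄ ↦ x`, is well defined (`(y/x)(z/x) = yz/x² = −x^e`), INJECTIVE (followed by the extension of `θ`
to `R[1/x]` it is the localization map `Rₑ → Rₑ[1/c̄]`, injective as `Rₑ` is a domain —
`isPrime_span_suspension`, file `Theorems/FrobeniusLadderFRationalResolutionQuadricConeResolution.lean`)
and has range EXACTLY the affine blowup algebra `R[I/x]`, `I = (x, y, z)` (`⊆`: `x`, `y/x`, `z/x`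
lie in it, `div_mem_blowupAlgebra`; `⊇`: `R = k[x, y, z]` by `hgen` with `y = (y/x)·x`,
`z = (z/x)·x`, and `w/x` for `w ∈ I` is an `R`-combination of `1, y/x, z/x`). So the `x`-chart of
`Bl_0 {yz + x^(e+2) = 0}` is `{ab + c^e = 0}`: the `A_m` tower descends by two. [Kollár 2007 §2.2;
folklore] -/
theorem stub_chart_elim_pow (k R : Type) [Field k] [CommRing R] [Algebra k R] (e : ℕ)
    (x y z : R) (hrel : y * z + x ^ (e + 2) = 0) (hgen : Algebra.adjoin k {x, y, z} = ⊤)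
    (θ : R →ₐ[k] Localization.Away (Ideal.Quotient.mk (Ideal.span
      {(MvPolynomial.X (Sum.inl 0) * MvPolynomial.X (Sum.inl 1) +
        MvPolynomial.rename Sum.inr (MvPolynomial.X 0 ^ e) : MvPolynomial (Fin 2 ⊕ Fin 1) k)})
      (MvPolynomial.X (Sum.inr 0))))
    (hθx : θ x = algebraMap _ _ (Ideal.Quotient.mk (Ideal.span
      {(MvPolynomial.X (Sum.inl 0) * MvPolynomial.X (Sum.inl 1) +
        MvPolynomial.rename Sum.inr (MvPolynomial.X 0 ^ e) : MvPolynomial (Fin 2 ⊕ Fin 1) k)})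
      (MvPolynomial.X (Sum.inr 0))))
    (hθy : θ y = algebraMap _ _ (Ideal.Quotient.mk (Ideal.span
      {(MvPolynomial.X (Sum.inl 0) * MvPolynomial.X (Sum.inl 1) +
        MvPolynomial.rename Sum.inr (MvPolynomial.X 0 ^ e) : MvPolynomial (Fin 2 ⊕ Fin 1) k)})
      (MvPolynomial.X (Sum.inl 0) * MvPolynomial.X (Sum.inr 0))))
    (hθz : θ z = algebraMap _ _ (Ideal.Quotient.mk (Ideal.span
      {(MvPolynomial.X (Sum.inl 0) * MvPolynomial.X (Sum.inl 1) +
        MvPolynomial.rename Sum.inr (MvPolynomial.X 0 ^ e) : MvPolynomial (Fin 2 ⊕ Fin 1) k)})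
      (MvPolynomial.X (Sum.inl 1) * MvPolynomial.X (Sum.inr 0)))) :
    ∃ φ : (MvPolynomial (Fin 2 ⊕ Fin 1) k ⧸ Ideal.span
        {(MvPolynomial.X (Sum.inl 0) * MvPolynomial.X (Sum.inl 1) +
          MvPolynomial.rename Sum.inr (MvPolynomial.X 0 ^ e) : MvPolynomial (Fin 2 ⊕ Fin 1) k)}) →ₐ[k]
        Localization.Away x,
      Function.Injective φ ∧
      Set.range φ = (blowupAlgebra (Ideal.span {x, y, z}) x : Set (Localization.Away x)) ∧
      φ (Ideal.Quotient.mk _ (MvPolynomial.X (Sum.inr 0))) = algebraMap R _ x ∧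
      φ (Ideal.Quotient.mk _ (MvPolynomial.X (Sum.inl 0))) * algebraMap R _ x = algebraMap R _ y ∧
      φ (Ideal.Quotient.mk _ (MvPolynomial.X (Sum.inl 1))) * algebraMap R _ x = algebraMap R _ z :=
  -- LANDED p140283 (`Theorems/FrobeniusLadderFRationalResolutionChartElimPow.lean`)
  Summit.ResolutionOfSingularities.ResolutionOfSingularities.Theorems.FRationalResolution.stub_chart_elim_pow k R e x y z hrel hgen θ hθx hθy hθz

/-- STUB (worker, H1) — GLUING A RESOLUTION INTO A REGULAR OPEN (open gluing infrastructure). `X` a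
scheme covered by the ranges of two open immersions `iU : U → X`, `iV : V → X`, with `U` regular, and
`ρ : Y → V` proper from a regular `Y` which is an ISOMORPHISM over `U ∩ V ⊆ V` (and whose preimage
of `U ∩ V` is dense in `Y`). Then `X` receives a proper morphism `π : X' → X` from a regular scheme
which is an isomorphism over `U` (with dense preimage of `U`): `X' = U ⨿_{U ∩ V} Y`, the push-out of
the open immersions `U ∩ V → U` and `U ∩ V ≅ ρ⁻¹(U ∩ V) → Y` (Mathlib: colimits of locally directed
diagrams of open immersions, `AlgebraicGeometry.Scheme.IsLocallyDirected` section of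
`Mathlib/AlgebraicGeometry/Gluing.lean`: `HasColimit`, `colimit.ι` open immersions and jointly
surjective, `ι_eq_ι_iff`; the instance for `WidePushoutShape`-indexed diagrams), `π = colimit.desc`
of `iU` and `ρ ≫ iV`; `π⁻¹(U) = ι(U) ≅ U` and `π⁻¹(V) = ι(Y) ≅ Y` over `V`, so `π` is proper
(`IsProper` is Zariski-local at the target) and `X'` is regular (stalks of open subschemes).
[Stacks 01JA (gluing schemes); folklore] -/
theorem stub_hasResolution_glue (X U V Y : Scheme.{0}) (iU : U ⟶ X) [IsOpenImmersion iU]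
    (iV : V ⟶ X) [IsOpenImmersion iV] (hcover : iU.opensRange ⊔ iV.opensRange = ⊤)
    (hU : Scheme.IsRegular U) (ρ : Y ⟶ V) [IsProper ρ] (hY : Scheme.IsRegular Y)
    (hiso : IsIso (ρ ∣_ (iV ⁻¹ᵁ iU.opensRange)))
    (hd : Dense ((ρ ⁻¹ᵁ (iV ⁻¹ᵁ iU.opensRange) : Y.Opens) : Set Y)) :
    ∃ (X' : Scheme.{0}) (π : X' ⟶ X), IsProper π ∧ Scheme.IsRegular X' ∧
      IsIso (π ∣_ iU.opensRange) ∧ Dense ((π ⁻¹ᵁ iU.opensRange : X'.Opens) : Set X') :=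
  -- LANDED p140532 (`Theorems/FrobeniusLadderFRationalResolutionResolutionOpenGlue.lean`)
  Summit.ResolutionOfSingularities.ResolutionOfSingularities.Theorems.FRationalResolution.stub_hasResolution_glue X U V Y iU iV hcover hU ρ hY hiso hd

/-! ### Assembly of wave 2 (lead): the Gorenstein form of the sector theorem -/

/-- **F-RATIONAL + ONE IRREDUCIBLE PARAMETER IDEAL ⇒ WEAKLY F-REGULAR** (Hochster–Huneke 1994 for
GORENSTEIN rings, in the tree's vocabulary "Cohen–Macaulay of type 1"; the Cohen–Macaulayness is
itself a consequence of F-rationality, Hochster–Huneke 1994 Thm. 4.2 (c), proved in the tree by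
colon capturing, `isWeaklyRegular_of_fRational_clause_quotient`, c1). Let `S` be a regular local ring
of prime characteristic `p`, `Q` a prime ideal, `R = S/Q`. If every parameter ideal of `R` is tightly
closed (the crux's inline clause) and SOME parameter ideal `(Q₁)` (`dim R` elements of `𝔪_R`
generating an `𝔪_R`-primary ideal) has cyclic socle, then every ideal of `R` is tightly closed. -/
theorem weaklyFRegular_of_fRational_gorenstein (p : ℕ) [Fact p.Prime] (S : Type) [CommRing S]
    [IsRegularLocalRing S] [CharP S p] (Q : Ideal S) [Q.IsPrime] [IsLocalRing (S ⧸ Q)]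
    (hFR : ∀ d : ℕ, ringKrullDim (S ⧸ Q) = d → ∀ s : Fin d → S ⧸ Q,
      (Ideal.span (Set.range s)).radical.IsMaximal → ∀ y c : S ⧸ Q, c ≠ 0 →
      (∀ e : ℕ, c * y ^ p ^ e ∈ Ideal.span ((fun z : S ⧸ Q => z ^ p ^ e) ''
        (Ideal.span (Set.range s) : Set (S ⧸ Q)))) → y ∈ Ideal.span (Set.range s))
    (Q₁ : List (S ⧸ Q)) (h₁ : (Q₁.length : WithBot ℕ∞) = ringKrullDim (S ⧸ Q))
    (hm₁ : ∀ q ∈ Q₁, q ∈ IsLocalRing.maximalIdeal (S ⧸ Q)) (N₁ : ℕ)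
    (hN₁ : IsLocalRing.maximalIdeal (S ⧸ Q) ^ N₁ ≤ Ideal.ofList Q₁) (t₁ : S ⧸ Q)
    (hsoc : (Ideal.ofList Q₁).colon (IsLocalRing.maximalIdeal (S ⧸ Q) : Set (S ⧸ Q)) =
      Ideal.ofList Q₁ ⊔ Ideal.span {t₁})
    (I : Ideal (S ⧸ Q)) (y c : S ⧸ Q) (hc : c ≠ 0)
    (hy : ∀ e : ℕ, c * y ^ p ^ e ∈ Ideal.span ((fun z : S ⧸ Q => z ^ p ^ e) '' (I : Set (S ⧸ Q)))) :
    y ∈ I := by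
  -- F-rational ⇒ Cohen–Macaulay: every parameter LIST is a weakly regular sequence
  have hCM : ∀ L : List (S ⧸ Q), (L.length : WithBot ℕ∞) = ringKrullDim (S ⧸ Q) →
      (∀ q ∈ L, q ∈ IsLocalRing.maximalIdeal (S ⧸ Q)) →
      (∃ N : ℕ, IsLocalRing.maximalIdeal (S ⧸ Q) ^ N ≤ Ideal.ofList L) →
      RingTheory.Sequence.IsWeaklyRegular (S ⧸ Q) L := by
    intro L hL hLm ⟨N, hN⟩
    have hofFn : List.ofFn (fun i : Fin L.length => L.get i) = L := List.ofFn_get L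
    have hspan : Ideal.span (Set.range fun i : Fin L.length => L.get i) = Ideal.ofList L := by
      rw [Ideal.ofList, Set.range_list_get]
    have hrad : (Ideal.span (Set.range fun i : Fin L.length => L.get i)).radical.IsMaximal := by
      rw [hspan]
      have hle : Ideal.ofList L ≤ IsLocalRing.maximalIdeal (S ⧸ Q) :=
        Ideal.span_le.mpr fun q hq => hLm q hq
      have heq : (Ideal.ofList L).radical = IsLocalRing.maximalIdeal (S ⧸ Q) := by
        refine le_antisymm ?_ ?_
        · exact (Ideal.radical_mono hle).trans (Ideal.IsPrime.radical_le_iff inferInstance |>.mpr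
            le_rfl)
        · intro m hm
          exact ⟨N, hN (Ideal.pow_mem_pow hm N)⟩
      rw [heq]
      exact IsLocalRing.maximalIdeal.isMaximal _
    have h := Theorems.FRationalResolution.isWeaklyRegular_of_fRational_clause_quotient p S Q hFR
      hL.symm (fun i : Fin L.length => L.get i) hrad
    rwa [hofFn] at h
  refine weaklyFRegular_of_fRational_of_socle_cyclic p (S ⧸ Q) hFR (fun d hd s hs => ?_) I y c hc hy
  -- the parameter ideal `(s)` as a list
  have hlen : ((List.ofFn s).length : WithBot ℕ∞) = ringKrullDim (S ⧸ Q) := by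
    rw [List.length_ofFn, hd]
  have hspan : Ideal.ofList (List.ofFn s) = Ideal.span (Set.range s) := by
    rw [Ideal.ofList]
    congr 1
    ext q
    simp [List.mem_ofFn']
  have hmax : (Ideal.span (Set.range s)).radical = IsLocalRing.maximalIdeal (S ⧸ Q) :=
    IsLocalRing.eq_maximalIdeal hs
  have hsm : ∀ q ∈ List.ofFn s, q ∈ IsLocalRing.maximalIdeal (S ⧸ Q) := by
    intro q hq
    rw [← hmax]
    exact Ideal.le_radical (hspan ▸ Ideal.subset_span hq)
  obtain ⟨N, hN⟩ : ∃ N : ℕ, IsLocalRing.maximalIdeal (S ⧸ Q) ^ N ≤ Ideal.ofList (List.ofFn s) := by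
    rw [hspan]
    refine Ideal.exists_pow_le_of_le_radical_of_fg (hmax ▸ le_rfl) (IsNoetherian.noetherian _)
  obtain ⟨t, ht⟩ := stub_socle_cyclic_of_one (S ⧸ Q) hCM Q₁ (List.ofFn s) h₁ hlen hm₁ hsm N₁ N
    hN₁ hN t₁ hsoc
  exact ⟨t, by rw [← hspan]; exact ht⟩

/-! ## By-product stubs of continuation seat c3, wave 3 (2026-08-17): LOCAL-TO-GLOBAL for isolated
singularities, ONE SYSTEM OF PARAMETERS, and AFFINE-SPACE BASE CHANGE of resolutions

Three independent themes, each assembling (lead) into a headline: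

(L) **Resolution is Zariski-local for schemes with finitely many closed singular points.** The
symmetric open gluing `stub_hasResolution_glue2` (both opens modified; generalises
`stub_hasResolution_glue`) lets the lead glue, by induction over the finitely many singular points,
local resolutions (proper, regular source, an isomorphism off the point) of open neighbourhoods into a
resolution of `X`. With `finite_compl_regularLocus_of_fRational_surface` (c1) this makes RUNG 4′ FOR
F-RATIONAL SURFACES A LOCAL STATEMENT about each of the finitely many singular points.

(O) **F-rational ⇔ ONE parameter ideal tightly closed, for Cohen–Macaulay local rings** (the CM case
of Hochster–Huneke 1994 Thm. 4.2 (d) / Prop. 6.27 (a), named fact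
`Literature.RingTheory.TightClosure.HochsterHuneke1994_prop627a`, and of Fedder–Watanabe 1989 §2), by an
elementary exchange argument with NO local cohomology, test elements or transition determinants:
`stub_tc_power_step` ((J, a) tightly closed, `a` regular modulo every `J^[q]` ⇒ (J, a^M) tightly
closed) and `stub_tc_exchange` (a^M = w g + j, `a` regular mod `J`, (J, a^M) tightly closed ⇒ (J, g)
tightly closed: `u ↦ u w` moves `(J, g)^*` into `(J, a^M)^*`), run along the exchange chain of
parameter lists of `stub_socle_cyclic_of_one` (lead). In the crux's vocabulary: a CM locally-integral
model (rung 2's Cohen–Macaulay clause) is an F-rational model as soon as ONE parameter ideal per point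
is tightly closed.

(B) **Resolutions pull back along affine spaces**: `𝔸ⁿ` over a regular locally Noetherian scheme is
regular (`stub_isRegular_affineSpace`, Mathlib `MvPolynomial.isRegularRing_of_isRegularRing` on affine
charts), birationality is stable under `AffineSpace.map` (`stub_isBirational_affineSpace_map`, the
projection being open and surjective, Mathlib `AffineSpace.isOpenMap_over`, `isPullback_map`), so
`HasResolution X ⇒ HasResolution 𝔸(Fin n; X)` (lead); and `Σ(x₀^(m+1)) ⊂ 𝔸^(n+3)` IS
`𝔸(Fin n; A_m)` (`stub_suspensionPow_affineSpace_iso`), so with the `A_n` programme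
(`Theorems/…AnResolutionBase.lean`, `…AnResolutionStep.lean`: `hasResolution_An`) rung 4′ holds on
every `{yz + x₀^(m+1) = 0} ⊂ 𝔸^(n+3)`, every field — the first resolved members of the class with
NON-ISOLATED singular locus. -/

/-- STUB (worker, L1) — SYMMETRIC OPEN GLUING OF TWO RESOLUTIONS. `X` covered by the ranges of two open
immersions `iA : A → X`, `iB : B → X`; `W ⊆ X` an open containing `A ∩ B`; `α : A' → A` and
`β : B' → B` proper morphisms from regular schemes which are isomorphisms over `iA⁻¹ W` resp. `iB⁻¹ W`
with dense preimages of these. Then `X` receives a proper `π : X' → X` from a regular scheme, an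
isomorphism over `W` with dense preimage of `W`. Construction exactly as `stub_hasResolution_glue`
(file `Theorems/FrobeniusLadderFRationalResolutionResolutionOpenGlue.lean`, p140532: push-out of open
immersions in Mathlib, `openGlue_*` lemmas there are reusable): `X' = A' ⨿_{A ∩ B} B'`, glued along
`α⁻¹(A ∩ B) ≅ A ∩ B ≅ β⁻¹(A ∩ B)` (both restrictions are isomorphisms since `A ∩ B ⊆ W`,
`isIso_morphismRestrict_of_le`), `π = pushout.desc (α ≫ iA) (β ≫ iB)`; `π⁻¹(iA A) = inl A'` and
`π⁻¹(iB B) = inr B'` give `IsPullback α inl iA π`, `IsPullback β inr iB π`, so `π` is proper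
(Zariski-local on the target) and an isomorphism over `W ∩ A` and `W ∩ B`, hence over `W`
(`isIso_morphismRestrict_sup`); density from the two dense pieces. [Stacks 01JA; folklore] -/
theorem stub_hasResolution_glue2 (X A B A' B' : Scheme.{0}) (iA : A ⟶ X) [IsOpenImmersion iA]
    (iB : B ⟶ X) [IsOpenImmersion iB] (hcover : iA.opensRange ⊔ iB.opensRange = ⊤)
    (W : X.Opens) (hW : iA.opensRange ⊓ iB.opensRange ≤ W)
    (α : A' ⟶ A) [IsProper α] (hA' : Scheme.IsRegular A') (hα : IsIso (α ∣_ (iA ⁻¹ᵁ W)))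
    (hαd : Dense ((α ⁻¹ᵁ (iA ⁻¹ᵁ W) : A'.Opens) : Set A'))
    (β : B' ⟶ B) [IsProper β] (hB' : Scheme.IsRegular B') (hβ : IsIso (β ∣_ (iB ⁻¹ᵁ W)))
    (hβd : Dense ((β ⁻¹ᵁ (iB ⁻¹ᵁ W) : B'.Opens) : Set B')) :
    ∃ (X' : Scheme.{0}) (π : X' ⟶ X), IsProper π ∧ Scheme.IsRegular X' ∧ IsIso (π ∣_ W) ∧
      Dense ((π ⁻¹ᵁ W : X'.Opens) : Set X') :=
  -- LANDED p141507 (`Theorems/FrobeniusLadderFRationalResolutionResolutionOpenGlue2.lean`)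
  Summit.ResolutionOfSingularities.ResolutionOfSingularities.Theorems.FRationalResolution.stub_hasResolution_glue2 X A B A' B' iA iB hcover W hW α hA' hα hαd β hB' hβ hβd

/-- STUB (worker, O1) — POWER STEP FOR TIGHT CLOSURE. In a ring of prime characteristic `p`, let `J`
be an ideal and `a` an element that is a non-zero-divisor modulo every Frobenius power `J^[p^e]`
(`e = 0` included: modulo `J`). If `(J, a)` is tightly closed then so is `(J, a^M)` for every `M`.
Induction on `M`: `u ∈ (J, a^(M+1))^* ⊆ (J, a^M)^* = (J, a^M)`, `u = j + r a^M`; then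
`c rᵠ a^(Mq) ∈ J^[q] + (a^((M+1)q))` for `q ≫ 0`, so `a^(Mq) (c rᵠ − s aᵠ) ∈ J^[q]`, cancel `a^(Mq)`,
`c rᵠ ∈ (J, a)^[q]`, `r ∈ (J, a)^* = (J, a)`, `u ∈ (J, a^(M+1))`. (Frobenius powers of `J ⊔ span {b}`:
`frobeniusPower_span`, `Ideal.span_union` / `Submodule.mem_sup`, `Ideal.mem_span_singleton`.)
[folklore; cf. HochsterHuneke1994 proof of Thm. 4.2] -/
theorem stub_tc_power_step (p : ℕ) [Fact p.Prime] (R : Type) [CommRing R] [CharP R p]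
    (J : Ideal R) (a : R)
    (ha : ∀ (e : ℕ) (z : R), z * a ∈ Literature.RingTheory.TightClosure.frobeniusPower (p ^ e) J →
      z ∈ Literature.RingTheory.TightClosure.frobeniusPower (p ^ e) J)
    (htc : Literature.RingTheory.TightClosure.IsTightlyClosed p (J ⊔ Ideal.span {a})) (M : ℕ) :
    Literature.RingTheory.TightClosure.IsTightlyClosed p (J ⊔ Ideal.span {a ^ M}) :=
  -- LANDED p142419 (`Theorems/FrobeniusLadderFRationalResolutionTightClosurePowerStep.lean`)
  Summit.ResolutionOfSingularities.ResolutionOfSingularities.Theorems.FRationalResolution.stub_tc_power_step p R J a ha htc M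

/-- STUB (worker, O2) — EXCHANGE STEP FOR TIGHT CLOSURE. In a ring of prime characteristic `p`, let
`J` be an ideal, `a` a non-zero-divisor modulo `J`, and `a^M = w g + j` with `j ∈ J`. If `(J, a^M)` is
tightly closed then `(J, g)` is tightly closed. Proof: for `u ∈ (J, g)^*`, `c uᵠ ∈ J^[q] + (gᵠ)` for
`q ≫ 0`, hence `c (u w)ᵠ ∈ J^[q] + ((w g)ᵠ) = J^[q] + ((a^M − j)ᵠ) ⊆ J^[q] + (a^(Mq))`
(`sub_pow_char_pow` / `sub_pow_expChar_pow`), so `u w ∈ (J, a^M)^* = (J, a^M)`,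
`u w = j' + r a^M = j' + r (w g + j)`, `w (u − r g) ∈ J`; and `w` is a non-zero-divisor mod `J`
(`w z ∈ J ⇒ a^M z = w g z + j z ∈ J ⇒ z ∈ J`), so `u ∈ (J, g)`. [folklore] -/
theorem stub_tc_exchange (p : ℕ) [Fact p.Prime] (R : Type) [CommRing R] [CharP R p]
    (J : Ideal R) (a g w j : R) (M : ℕ) (hj : j ∈ J) (haM : a ^ M = w * g + j)
    (ha : ∀ z : R, z * a ∈ J → z ∈ J)
    (htc : Literature.RingTheory.TightClosure.IsTightlyClosed p (J ⊔ Ideal.span {a ^ M})) :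
    Literature.RingTheory.TightClosure.IsTightlyClosed p (J ⊔ Ideal.span {g}) :=
  -- LANDED p141408 (`Theorems/FrobeniusLadderFRationalResolutionTightClosureExchange.lean`)
  Summit.ResolutionOfSingularities.ResolutionOfSingularities.Theorems.FRationalResolution.stub_tc_exchange p R J a g w j M hj haM ha htc

/-- STUB (worker, B1) — AFFINE SPACE OVER A REGULAR SCHEME IS REGULAR. For a locally Noetherian
scheme `X` all of whose stalks are regular local rings and every `n`, the affine space `𝔸(Fin n; X)`
(Mathlib `AlgebraicGeometry.AffineSpace`) is regular. Proof: a point of `𝔸ⁿ_X` maps to a point of an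
affine open `U = Spec R` of `X`, `R = Γ(X, U)` a regular ring (`Scheme.IsRegular.isRegularRing_of_isAffineOpen`,
file `Literature/AlgebraicGeometry/Resolution/ProjectiveSpaceRegular.lean`); the base change
`AffineSpace.map (Fin n) U.ι : 𝔸ⁿ_U → 𝔸ⁿ_X` is an open immersion (pull-back of one,
`AffineSpace.isPullback_map`) whose range is the preimage of `U`, and
`𝔸ⁿ_U ≅ 𝔸ⁿ_{Spec R} ≅ Spec R[x₁, …, xₙ]` (`AffineSpace.SpecIso`, `AffineSpace.map` of an iso) is regular
by Mathlib `MvPolynomial.isRegularRing_of_isRegularRing` and `Scheme.isRegular_Spec`; conclude with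
`Scheme.IsRegular.of_forall_exists_isOpenImmersion`. [Matsumura1987 Thm. 19.5; folklore] -/
theorem stub_isRegular_affineSpace (n : ℕ) (X : Scheme.{0}) [IsLocallyNoetherian X]
    (hX : Scheme.IsRegular X) : Scheme.IsRegular (AffineSpace (Fin n) X) :=
  -- LANDED p142822 (`Theorems/FrobeniusLadderFRationalResolutionAffineSpaceRegular.lean`)
  Summit.ResolutionOfSingularities.ResolutionOfSingularities.Theorems.FRationalResolution.stub_isRegular_affineSpace n X hX

/-- STUB (worker, B2) — BIRATIONALITY IS STABLE UNDER `𝔸ⁿ`-BASE CHANGE. If `π : X' → X` is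
birational in the tree's sense (`IsBirational`: an isomorphism over a dense open `U` with dense
preimage), then so is `AffineSpace.map (Fin n) π : 𝔸ⁿ_{X'} → 𝔸ⁿ_X`: take `U' = p⁻¹ U` for the
projection `p : 𝔸ⁿ_X → X`, dense since `p` is an open map (Mathlib `AffineSpace.isOpenMap_over`,
`Dense.preimage`); its preimage `p'⁻¹(π⁻¹ U)` is dense likewise (`AffineSpace.map_over`); and
`AffineSpace.map (Fin n) π` restricted over `U'` is a base change of the isomorphism `π ∣_ U`
(`AffineSpace.isPullback_map`, `isPullback_morphismRestrict`, pasting), hence an isomorphism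
(`MorphismProperty.isomorphisms` is stable under base change). [folklore] -/
theorem stub_isBirational_affineSpace_map (n : ℕ) (X' X : Scheme.{0}) (π : X' ⟶ X)
    (hπ : IsBirational π) : IsBirational (AffineSpace.map (Fin n) π) :=
  -- LANDED p141453 (`Theorems/FrobeniusLadderFRationalResolutionAffineSpaceBirational.lean`)
  Summit.ResolutionOfSingularities.ResolutionOfSingularities.Theorems.FRationalResolution.stub_isBirational_affineSpace_map n X' X π hπ

/-- STUB (worker, B4) — `Σ(x₀^(m+1)) ⊂ 𝔸^(n+3)` IS `𝔸ⁿ` OVER THE `A_m` SURFACE. For every field `k` and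
all `n m`, the hypersurface `Spec k[y, z, x₀, …, xₙ]/(yz + x₀^(m+1))` (c2 suspension convention:
`MvPolynomial (Fin 2 ⊕ Fin (n+1)) k`, `y = X (inl 0)`, `z = X (inl 1)`, `xᵢ = X (inr i)`) is isomorphic
to `𝔸(Fin n; A_m)`, `A_m = Spec k[y, z, x]/(yz + x^(m+1))` (`MvPolynomial (Fin 2 ⊕ Fin 1) k`). Proof:
`AffineSpace.SpecIso : 𝔸(Fin n; Spec R) ≅ Spec (MvPolynomial (Fin n) R)` and the ring isomorphism
`MvPolynomial (Fin n) (S ⧸ (g)) ≅ MvPolynomial (Fin n) S ⧸ (g) ≅ k[y,z,x₀..xₙ] ⧸ (g')`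
(Mathlib `MvPolynomial.quotientEquivQuotientMvPolynomial`, `MvPolynomial.sumAlgEquiv`,
`MvPolynomial.renameEquiv` along `(Fin 2 ⊕ Fin 1) ⊕ Fin n ≃ Fin 2 ⊕ Fin (n + 1)` sending
`inl (inr 0) ↦ inr 0`, `Ideal.map_span` of the singleton, `Ideal.quotientEquiv`), then
`Scheme.Spec.mapIso` / `RingEquiv.toCommRingCatIso`. [folklore] -/
theorem stub_suspensionPow_affineSpace_iso (k : Type) [Field k] (n m : ℕ) :
    Nonempty (Spec (CommRingCat.of (MvPolynomial (Fin 2 ⊕ Fin (n + 1)) k ⧸ Ideal.span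
        {(MvPolynomial.X (Sum.inl 0) * MvPolynomial.X (Sum.inl 1) +
          MvPolynomial.rename Sum.inr (MvPolynomial.X 0 ^ (m + 1)) :
            MvPolynomial (Fin 2 ⊕ Fin (n + 1)) k)})) ≅
      AffineSpace (Fin n) (Spec (CommRingCat.of (MvPolynomial (Fin 2 ⊕ Fin 1) k ⧸ Ideal.span
        {(MvPolynomial.X (Sum.inl 0) * MvPolynomial.X (Sum.inl 1) +
          MvPolynomial.rename Sum.inr (MvPolynomial.X 0 ^ (m + 1)) :
            MvPolynomial (Fin 2 ⊕ Fin 1) k)})))) :=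
  -- LANDED p141473 (`Theorems/FrobeniusLadderFRationalResolutionSuspensionPowAffineSpace.lean`)
  Summit.ResolutionOfSingularities.ResolutionOfSingularities.Theorems.FRationalResolution.stub_suspensionPow_affineSpace_iso k n m

/-! ### Assembly of wave 3 (lead) — LANDED: p145288 `FRationalOfOneSop` (theme O), p148038
`AffineSpaceResolution` (theme B, general lemma), p140737 `AnResolutionBase` + p147943 `TowerStep` (rung 4′
on the `A_n` family: base and abstract tower step; the concrete descent `hasResolution_An` and the
`Σ(x₀^(m+1))` corollary follow in `…AnResolutionStep.lean` / `…SuspensionPowResolution.lean`), theme L's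
induction `stub_hasResolution_of_local_resolutions` delegated (wave 4). -/

/-- **THEME O: F-RATIONALITY IS DETECTED BY ONE PARAMETER IDEAL** (Cohen–Macaulay local domains of
characteristic `p`; CM case of Hochster–Huneke 1994 Thm. 4.2 (d) / Prop. 6.27 (a), elementary proof over
`stub_tc_power_step` + `stub_tc_exchange`): rung 2's CM clause + ONE tightly closed parameter ideal ⇒ the
F-rational clause of rungs 3/4. [cite: HochsterHuneke1994, Thm. 4.2 (d)] -/
theorem oneParameterIdeal_criterion (p : ℕ) [Fact p.Prime] (R : Type) [CommRing R] [IsDomain R]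
    [CharP R p] [IsNoetherianRing R] [IsLocalRing R]
    (hCM : ∀ d : ℕ, ringKrullDim R = d → ∀ s : Fin d → R,
      (Ideal.span (Set.range s)).radical.IsMaximal → RingTheory.Sequence.IsWeaklyRegular R (List.ofFn s))
    {d₀ : ℕ} (hd₀ : ringKrullDim R = d₀) (s₀ : Fin d₀ → R)
    (hs₀ : (Ideal.span (Set.range s₀)).radical.IsMaximal)
    (htc₀ : ∀ y c : R, c ≠ 0 → (∀ e : ℕ, c * y ^ p ^ e ∈
      Ideal.span ((fun z : R => z ^ p ^ e) '' (Ideal.span (Set.range s₀) : Set R))) →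
      y ∈ Ideal.span (Set.range s₀)) :
    ∀ d : ℕ, ringKrullDim R = d → ∀ s : Fin d → R, (Ideal.span (Set.range s)).radical.IsMaximal →
      ∀ y c : R, c ≠ 0 → (∀ e : ℕ, c * y ^ p ^ e ∈
        Ideal.span ((fun z : R => z ^ p ^ e) '' (Ideal.span (Set.range s) : Set R))) →
        y ∈ Ideal.span (Set.range s) :=
  Summit.ResolutionOfSingularities.ResolutionOfSingularities.Theorems.FRationalResolution.fRationalClause_of_one p R hCM hd₀ s₀ hs₀ htc₀

/-- **THEME B: RESOLUTIONS PULL BACK ALONG AFFINE SPACES** (`HasResolution X ⇒ HasResolution 𝔸ⁿ_X`,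
`X` locally Noetherian; over `stub_isRegular_affineSpace` + `stub_isBirational_affineSpace_map`). [folklore] -/
theorem resolutions_pullBack_affineSpace (n : ℕ) (X : Scheme.{0}) [IsLocallyNoetherian X]
    (h : Scheme.HasResolution X) : Scheme.HasResolution (AffineSpace (Fin n) X) :=
  Summit.ResolutionOfSingularities.ResolutionOfSingularities.Theorems.FRationalResolution.hasResolution_affineSpace n X h

/-! ### Waves 4–6 (lead c3, cycles 3–4) — LANDED: p149060 `ResolutionLocal` (resolution is Zariski-local for finitely many
closed singular points), p149210 `ResolutionRestrict`, p149439 `FRationalSurfaceLocal` (THE CRUX IN DIMENSION 2 IS LOCAL),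
p150409/p150337/p150507 + p151811 `OneSopQuotient` (HOCHSTER–HUNEKE 1994 PROP. 6.27 (a) FOR `S/Q`, UNCONDITIONALLY). -/

/-- **THEME L: THE CRUX IN DIMENSION 2 IS LOCAL** — an integral F-rational surface `X/k` all of whose (finitely many, closed)
singular points have open neighbourhoods with local resolutions (iso off the point) has a resolution of singularities. [folklore] -/
theorem crux_dim2_is_local (p : ℕ) (hp : p.Prime) (k : Type) [Field k] [CharP k p] (X : Scheme.{0}) [IsIntegral X]
    (f : X ⟶ Spec (.of k)) [LocallyOfFiniteType f] [QuasiCompact f]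
    (hFR : ∀ x : X, IsDomain (X.presheaf.stalk x) ∧ ∀ d : ℕ, ringKrullDim (X.presheaf.stalk x) = d →
      ∀ s : Fin d → X.presheaf.stalk x, (Ideal.span (Set.range s)).radical.IsMaximal →
      ∀ y c : X.presheaf.stalk x, c ≠ 0 →
      (∀ e : ℕ, c * y ^ p ^ e ∈ Ideal.span ((fun z : X.presheaf.stalk x => z ^ p ^ e) ''
        (Ideal.span (Set.range s) : Set (X.presheaf.stalk x)))) → y ∈ Ideal.span (Set.range s))
    (hdim : topologicalKrullDim X ≤ 2)
    (hloc : ∀ s : X, s ∉ Scheme.regularLocus X → ∃ (V : X.Opens), s ∈ V ∧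
      (∀ t : X, t ∉ Scheme.regularLocus X → t ∈ V → t = s) ∧
      ∃ (Y : Scheme.{0}) (ρ : Y ⟶ V), IsProper ρ ∧ Scheme.IsRegular Y ∧
        IsIso (ρ ∣_ (V.ι ⁻¹ᵁ ⟨Scheme.regularLocus X, isOpen_regularLocus_of_locallyOfFiniteType_field f⟩)) ∧
        Dense ((ρ ⁻¹ᵁ (V.ι ⁻¹ᵁ ⟨Scheme.regularLocus X,
          isOpen_regularLocus_of_locallyOfFiniteType_field f⟩) : Y.Opens) : Set Y)) :
    Scheme.HasResolution X :=
  Summit.ResolutionOfSingularities.ResolutionOfSingularities.Theorems.FRationalResolution.hasResolution_fRational_surface_of_local p hp k X f hFR hdim hloc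

/-- **THEME C: HOCHSTER–HUNEKE 1994, PROP. 6.27 (a), FOR THE STALKS THE ROUTE MEETS** (`S/Q`, `S` regular local of
characteristic `p`, `Q` prime): one tightly closed system-of-parameters ideal ⇒ Cohen–Macaulay and F-rational, unconditionally.
[cite: HochsterHuneke1994, Prop. 6.27 (a)] -/
theorem prop627a_for_stalks (p : ℕ) [Fact p.Prime] (S : Type) [CommRing S] [IsRegularLocalRing S] [CharP S p] (Q : Ideal S)
    [Q.IsPrime] [IsLocalRing (S ⧸ Q)] [CharP (S ⧸ Q) p] (d : ℕ) (hd : ringKrullDim (S ⧸ Q) = d)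
    (h : ∃ s : Fin d → S ⧸ Q, IsSystemOfParameters s ∧ IsTightlyClosed p (Ideal.span (Set.range s))) :
    (∃ rs : List (S ⧸ Q), RingTheory.Sequence.IsRegular (S ⧸ Q) rs ∧ (∀ r ∈ rs, r ∈ IsLocalRing.maximalIdeal (S ⧸ Q)) ∧
      rs.length = d) ∧ IsFRational (S ⧸ Q) p :=
  Summit.ResolutionOfSingularities.ResolutionOfSingularities.Theorems.FRationalResolution.prop627a_quotient p S Q d hd h

/-! ### Rung 4′ descents landed by the lead (c3): p148196 `AnResolutionStep` (`hasResolution_An` — EVERY `A_n`, every field,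
by a genuine tower of point blow-ups), p149973 `SuspensionPowResolution`, p151863 `FRationalSurfaceAnCharts`. -/

/-- **RUNG 4′ ON ALL `A_n`**: `Spec k[y,z,x]/(yz + x^(n+1))` has a resolution of singularities, for every field `k` and every
`n`, by the tower of `⌈n/2⌉` point blow-ups (`towerStep`). [folklore; Kollár 2007 §2.2, Lipman 1978 §2] -/
theorem rung4_An (k : Type) [Field k] (n : ℕ) :
    Scheme.HasResolution (Spec (CommRingCat.of (MvPolynomial (Fin 2 ⊕ Fin 1) k ⧸ Ideal.span
      {(MvPolynomial.X (Sum.inl 0) * MvPolynomial.X (Sum.inl 1) +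
        MvPolynomial.rename Sum.inr (MvPolynomial.X 0 ^ (n + 1)) : MvPolynomial (Fin 2 ⊕ Fin 1) k)}))) :=
  Summit.ResolutionOfSingularities.ResolutionOfSingularities.Theorems.FRationalResolution.hasResolution_An k n

/-- **RUNG 4′ ON ALL SUSPENDED POWERS** `Σ(x₀^(m+1)) = Spec k[y,z,x₀,…,x_n]/(yz + x₀^(m+1)) ≅ 𝔸ⁿ × A_m`: resolvable for every
field, all `n, m` (A_m tower carried along the affine space). [folklore] -/
theorem rung4_suspensionPow (k : Type) [Field k] (n m : ℕ) :
    Scheme.HasResolution (Spec (CommRingCat.of (MvPolynomial (Fin 2 ⊕ Fin (n + 1)) k ⧸ Ideal.span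
      {(MvPolynomial.X (Sum.inl 0) * MvPolynomial.X (Sum.inl 1) +
        MvPolynomial.rename Sum.inr (MvPolynomial.X 0 ^ (m + 1)) :
          MvPolynomial (Fin 2 ⊕ Fin (n + 1)) k)}))) :=
  Summit.ResolutionOfSingularities.ResolutionOfSingularities.Theorems.FRationalResolution.hasResolution_suspensionPow k n m

/-- **SHOWCASE (themes L + 4′ together): F-RATIONAL SURFACES WITH `A_n` CHARTS AT THEIR SINGULAR POINTS ARE RESOLVABLE** —
unconditionally, every field of characteristic `p`. [folklore] -/
theorem showcase_fRational_surface_An_charts (p : ℕ) (hp : p.Prime) (k : Type) [Field k]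
    [CharP k p] (X : Scheme.{0}) [IsIntegral X] (f : X ⟶ Spec (.of k)) [LocallyOfFiniteType f]
    [QuasiCompact f]
    (hFR : ∀ x : X, IsDomain (X.presheaf.stalk x) ∧ ∀ d : ℕ, ringKrullDim (X.presheaf.stalk x) = d →
      ∀ s : Fin d → X.presheaf.stalk x, (Ideal.span (Set.range s)).radical.IsMaximal →
      ∀ y c : X.presheaf.stalk x, c ≠ 0 →
      (∀ e : ℕ, c * y ^ p ^ e ∈ Ideal.span ((fun z : X.presheaf.stalk x => z ^ p ^ e) ''
        (Ideal.span (Set.range s) : Set (X.presheaf.stalk x)))) → y ∈ Ideal.span (Set.range s))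
    (hdim : topologicalKrullDim X ≤ 2)
    (hchart : ∀ s : X, s ∉ Scheme.regularLocus X → ∃ (V : X.Opens) (n : ℕ)
      (j : (V : Scheme.{0}) ⟶ Spec (CommRingCat.of (MvPolynomial (Fin 2 ⊕ Fin 1) k ⧸ Ideal.span
        {(MvPolynomial.X (Sum.inl 0) * MvPolynomial.X (Sum.inl 1) +
          MvPolynomial.rename Sum.inr (MvPolynomial.X 0 ^ (n + 1)) : MvPolynomial (Fin 2 ⊕ Fin 1) k)}))),
      s ∈ V ∧ (∀ t : X, t ∉ Scheme.regularLocus X → t ∈ V → t = s) ∧ IsOpenImmersion j ∧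
      j ⁻¹ᵁ ((PrimeSpectrum.basicOpen (Ideal.Quotient.mk _ (MvPolynomial.X (Sum.inl 0))) ⊔
          PrimeSpectrum.basicOpen (Ideal.Quotient.mk _ (MvPolynomial.X (Sum.inl 1))) ⊔
          PrimeSpectrum.basicOpen (Ideal.Quotient.mk _ (MvPolynomial.X (Sum.inr 0)))) :
            (Spec (CommRingCat.of (MvPolynomial (Fin 2 ⊕ Fin 1) k ⧸ Ideal.span
              {(MvPolynomial.X (Sum.inl 0) * MvPolynomial.X (Sum.inl 1) +
                MvPolynomial.rename Sum.inr (MvPolynomial.X 0 ^ (n + 1)) :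
                  MvPolynomial (Fin 2 ⊕ Fin 1) k)}))).Opens) =
        V.ι ⁻¹ᵁ ⟨Scheme.regularLocus X, isOpen_regularLocus_of_locallyOfFiniteType_field f⟩) :
    Scheme.HasResolution X :=
  Summit.ResolutionOfSingularities.ResolutionOfSingularities.Theorems.FRationalResolution.hasResolution_fRational_surface_of_An_charts p hp k X f hFR hdim hchart

/-! ### Cycles 5–7 (lead c3) — LANDED.
Cycle 5 (waves 7–8): p153578 `SmoothBaseChange` (resolutions pull back along smooth morphisms),
p153612 `StalkPresentationRegular`, p153613 `HypersurfaceOneSop`, p153645 `SpreadOutFinite` (redirect X₁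
Stub 2 free when Sing X finite / in dim 2), p153608 `ModelOpenGlue`, p153668 `DiagonalizableQuotientPerfect`
(redirect X₂ Stub 2 for perfect k mod Bergh–Rydh), p153611 `OneSopStalk` + p154402 `OneSopScheme` (HH94
6.27(a) AT STALKS), p154328 `ModelLocal` + p154674 `WeaklyFRegularModelLocal` (THE PUNCTUAL ENGINE IS PUNCTUAL),
p154444 `FRationalCMStalk`.
Cycle 6 (waves 9–10, theme LOC): p154744 `PrimeAdaptedParameters`, p155432 `SopExtension`, p154709
`MultiplierOffMinimalPrime`, p155088 `AtPrimeQuotientPresentation`, p154915 `FRationalLocalizesCore`, p155925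
`FrobeniusPowerUnmixed`, p156623 `FRationalLocalizes` (HH94 Thm 4.2(f): F-RATIONALITY LOCALIZES for S/Q),
p157423 `FRationalLocalizesScheme` (THE CRUX HYPOTHESIS IS A CLOSED-POINT CONDITION; THE CERTIFICATION THEOREM).
Cycle 7 (waves 11–12, theme D2R): p155492 `WeaklyFRegularSurfaceLocal` (X₁ in dim 2 is punctual), p156707
`GorensteinGermIdentityModel`, p156834 `ModelIntegral`, p156787 `ModelDimension`, p157513 `SurfacesOfGerms` (THE CRUX FOR
SURFACES FROM TWO ONE-GERM PROBLEMS); cycle 8: p157613 `SurfaceRungsOfGerms` (rung 3½ for surfaces ⇐ G1; rung 4′ for integral surfaces ⇐ G2).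
Cycle 9 (waves 13–14, theme REC): p158279 `StalkIsoSpread`, p158381 `RegularLocusOpenImmersion`, p158396 `AnRegularLocus`, p158684
`MutualInverseOpenImmersion`, p158387 `GermEqLocal`, p159158 `StalkIsoNhd` (ZARISKI-LOCAL RECOGNITION), p160375 `FRationalSurfaceAnStalks`
(INTRINSIC A_n SHOWCASE); cycle 10: p160881 `StalkIsoOpensIso`, p161068 `AnStalkLocalResolution` ((G2) for A_n germs on stalks). -/

/-- **TRANSFER: resolutions pull back along smooth morphisms.** [folklore; EGA IV 17.5.8] -/
theorem transfer_smooth {X Y : Scheme.{0}} [IsLocallyNoetherian X] (g : Y ⟶ X) [Smooth g]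
    (h : Scheme.HasResolution X) : Scheme.HasResolution Y :=
  Summit.ResolutionOfSingularities.ResolutionOfSingularities.Theorems.FRationalResolution.hasResolution_of_smooth g h

/-- **THE CERTIFICATION THEOREM (HH94 6.27(a) at stalks + 4.2(f) localization, both proved for
`S/Q`).** One tightly closed system-of-parameters ideal at each CLOSED SINGULAR point certifies the
crux's F-rational hypothesis at every point of a k-scheme locally of finite type.
[cite: HochsterHuneke1994, Prop. 6.27 (a), Thm. 4.2 (f)] -/
theorem certification (p : ℕ) (hp : p.Prime) (k : Type) [Field k] [CharP k p] (X : Scheme.{0})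
    (f : X ⟶ Spec (.of k)) [LocallyOfFiniteType f]
    (h : ∀ y : X, IsClosed ({y} : Set X) → y ∉ Scheme.regularLocus X →
      IsDomain (X.presheaf.stalk y) ∧ ∃ (d₀ : ℕ) (s₀ : Fin d₀ → X.presheaf.stalk y),
      ringKrullDim (X.presheaf.stalk y) = d₀ ∧ (Ideal.span (Set.range s₀)).radical.IsMaximal ∧
      ∀ z c : X.presheaf.stalk y, c ≠ 0 → (∀ e : ℕ, c * z ^ p ^ e ∈
        Ideal.span ((fun w : X.presheaf.stalk y => w ^ p ^ e) ''
          (Ideal.span (Set.range s₀) : Set (X.presheaf.stalk y)))) →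
        z ∈ Ideal.span (Set.range s₀)) :
    ∀ x : X, IsDomain (X.presheaf.stalk x) ∧ ∀ d : ℕ, ringKrullDim (X.presheaf.stalk x) = d →
      ∀ s : Fin d → X.presheaf.stalk x, (Ideal.span (Set.range s)).radical.IsMaximal →
      ∀ y c : X.presheaf.stalk x, c ≠ 0 →
      (∀ e : ℕ, c * y ^ p ^ e ∈ Ideal.span ((fun z : X.presheaf.stalk x => z ^ p ^ e) ''
        (Ideal.span (Set.range s) : Set (X.presheaf.stalk x)))) → y ∈ Ideal.span (Set.range s) :=
  Summit.ResolutionOfSingularities.ResolutionOfSingularities.Theorems.FRationalResolution.fRationalHypothesis_of_one_sop_at_singular_closedPoints p hp k X f h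

/-- **F-RATIONALITY LOCALIZES (HH94 Thm 4.2(f)) for `S/Q`, ring level.**
[cite: HochsterHuneke1994, Thm. 4.2 (f)] -/
theorem toolkit_42f (p : ℕ) [Fact p.Prime] (S : Type) [CommRing S] [IsRegularLocalRing S]
    [CharP S p] (Q : Ideal S) [Q.IsPrime]
    (hFR : ∀ d : ℕ, ringKrullDim (S ⧸ Q) = d → ∀ s : Fin d → S ⧸ Q,
      (Ideal.span (Set.range s)).radical.IsMaximal → ∀ y c : S ⧸ Q, c ≠ 0 →
      (∀ e : ℕ, c * y ^ p ^ e ∈ Ideal.span ((fun z : S ⧸ Q => z ^ p ^ e) ''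
        (Ideal.span (Set.range s) : Set (S ⧸ Q)))) → y ∈ Ideal.span (Set.range s))
    (P : Ideal (S ⧸ Q)) [P.IsPrime] (A : Type) [CommRing A] [Algebra (S ⧸ Q) A]
    [IsLocalization.AtPrime A P] :
    IsDomain A ∧ ∀ d : ℕ, ringKrullDim A = d → ∀ s : Fin d → A,
      (Ideal.span (Set.range s)).radical.IsMaximal → ∀ y c : A, c ≠ 0 →
      (∀ e : ℕ, c * y ^ p ^ e ∈ Ideal.span ((fun z : A => z ^ p ^ e) ''
        (Ideal.span (Set.range s) : Set A))) → y ∈ Ideal.span (Set.range s) :=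
  Summit.ResolutionOfSingularities.ResolutionOfSingularities.Theorems.FRationalResolution.fRationalClause_atPrime p S Q hFR P A

/-- **REDIRECT X₁ · Stub 2 (`stub_spreadOut`) IS FREE IN DIMENSION 2.** [folklore] -/
theorem redirect_spreadOut_dim2 (p : ℕ) (hp : p.Prime) (k : Type) [Field k] [CharP k p]
    (X : Scheme.{0}) (f : X ⟶ Spec (.of k)) [LocallyOfFiniteType f] [QuasiCompact f] [IsIntegral X]
    (hFR : ∀ x : X, IsDomain (X.presheaf.stalk x) ∧ ∀ d : ℕ, ringKrullDim (X.presheaf.stalk x) = d →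
      ∀ s : Fin d → X.presheaf.stalk x, (Ideal.span (Set.range s)).radical.IsMaximal →
      ∀ y c : X.presheaf.stalk x, c ≠ 0 →
      (∀ e : ℕ, c * y ^ p ^ e ∈ Ideal.span ((fun z : X.presheaf.stalk x => z ^ p ^ e) ''
        (Ideal.span (Set.range s) : Set (X.presheaf.stalk x)))) → y ∈ Ideal.span (Set.range s))
    (hdim : topologicalKrullDim X ≤ 2) :
    ∃ (X' : Scheme.{0}) (π : X' ⟶ X), IsProper π ∧ IsBirational π ∧ IsIntegral X' ∧
      (∀ x : X', IsDomain (X'.presheaf.stalk x) ∧ ∀ d : ℕ, ringKrullDim (X'.presheaf.stalk x) = d →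
      ∀ s : Fin d → X'.presheaf.stalk x, (Ideal.span (Set.range s)).radical.IsMaximal →
      ∀ y c : X'.presheaf.stalk x, c ≠ 0 →
      (∀ e : ℕ, c * y ^ p ^ e ∈ Ideal.span ((fun z : X'.presheaf.stalk x => z ^ p ^ e) ''
        (Ideal.span (Set.range s) : Set (X'.presheaf.stalk x)))) → y ∈ Ideal.span (Set.range s)) ∧
      Set.Finite {x : X' | ¬ ((∀ I : Ideal (X'.presheaf.stalk x), ∀ y c : X'.presheaf.stalk x, c ≠ 0 →
          (∀ e : ℕ, c * y ^ p ^ e ∈ Ideal.span ((fun z : X'.presheaf.stalk x => z ^ p ^ e) ''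
            (I : Set (X'.presheaf.stalk x)))) → y ∈ I) ∨
        (∀ d : ℕ, ringKrullDim (X'.presheaf.stalk x) = d → ∀ s : Fin d → X'.presheaf.stalk x,
          (Ideal.span (Set.range s)).radical.IsMaximal →
          ∃ t : X'.presheaf.stalk x, (Ideal.span (Set.range s)).colon
            (IsLocalRing.maximalIdeal (X'.presheaf.stalk x) : Set (X'.presheaf.stalk x)) =
            Ideal.span (Set.range s) ⊔ Ideal.span {t}))} :=
  Summit.ResolutionOfSingularities.ResolutionOfSingularities.Theorems.FRationalResolution.spreadOut_of_dim_le_two p hp k X f hFR hdim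

/-- **REDIRECT X₂ · Stub 2 FOR PERFECT FIELDS, modulo Bergh–Rydh 2019 Thm 5.**
[cite: BerghRydh2019, Thm 5] -/
theorem redirect_diagonalizable_perfect
    (hBR : BerghRydh2019_diagonalizableQuotientResolution)
    (k : Type) [Field k] [PerfectField k] (X : Scheme.{0}) (g : X ⟶ Spec (.of k))
    [IsIntegral X] [IsSeparated g] [LocallyOfFiniteType g] [QuasiCompact g]
    (hq : ∀ x : X, ∃ (A : Type) (_ : AddCommGroup A) (_ : Finite A) (_ : DecidableEq A)
        (S : Type) (_ : CommRing S) (_ : Algebra k S) (𝒮 : A → Submodule k S)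
        (_ : GradedAlgebra 𝒮), Algebra.FiniteType k S ∧ IsRegularRing S ∧
        ∃ φ : Spec (.of (𝒮 0)) ⟶ X, Etale φ ∧ x ∈ Set.range φ ∧
          φ ≫ g = Spec.map (CommRingCat.ofHom (algebraMap k (𝒮 0)))) :
    Scheme.HasResolution X :=
  Summit.ResolutionOfSingularities.ResolutionOfSingularities.Theorems.FRationalResolution.diagonalizableQuotientResolution_of_perfectField hBR k X g hq

/-- **THE CRUX FOR SURFACES FROM TWO ONE-GERM PROBLEMS** (theme D2R): (1) non-Gorenstein F-rational
surface germs have proper weakly-F-regular local models; (2) weakly-F-regular surface germs have local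
resolutions ⇒ every integral separated finite-type F-rational surface has a resolution.
[folklore assembly] -/
alias crux_surfaces_of_two_germ_problems := Summit.ResolutionOfSingularities.ResolutionOfSingularities.Theorems.FRationalResolution.fRationalResolution_surfaces_of_two_germ_problems

/-- **RUNG 3½ FOR SURFACES ⇐ (G1)** (non-Gorenstein F-rational surface germs have proper weakly-F-regular local models).
[folklore assembly] -/
alias rung3half_surfaces_of_G1 := Summit.ResolutionOfSingularities.ResolutionOfSingularities.Theorems.FRationalResolution.weaklyFRegularModification_surfaces_of_G1

/-- **RUNG 4′ FOR INTEGRAL SURFACES ⇐ (G2)** (weakly-F-regular surface germs have local resolutions). [folklore assembly] -/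
alias rung4_surfaces_of_G2 := Summit.ResolutionOfSingularities.ResolutionOfSingularities.Theorems.FRationalResolution.weaklyFRegularResolution_surfaces_of_G2

/-- **ZARISKI-LOCAL RECOGNITION** (theme REC): a k-compatible isomorphism of stalks of integral finite-type k-schemes spreads to
an open immersion of a neighbourhood. [cite: StacksProject, Tag 0BX6; folklore] -/
alias recognition := Summit.ResolutionOfSingularities.ResolutionOfSingularities.Theorems.FRationalResolution.exists_isOpenImmersion_nhd_of_stalk_iso

/-- **INTRINSIC `A_n` SHOWCASE**: an integral F-rational surface whose singular stalks are k-isomorphic to `A_n` local rings is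
resolvable. [folklore; Kollár 2007 §2.2, Lipman 1978 §2] -/
alias showcase_fRational_surface_An_stalks := Summit.ResolutionOfSingularities.ResolutionOfSingularities.Theorems.FRationalResolution.hasResolution_fRational_surface_of_An_stalks

/-- **(G2) FOR `A_n` GERMS STATED ON STALKS**: a local resolution at any singular point whose stalk is k-isomorphic to an
`A_n` local ring. [folklore; Kollár 2007 §2.2, Lipman 1978 §2] -/
alias G2_An_stalk := Summit.ResolutionOfSingularities.ResolutionOfSingularities.Theorems.FRationalResolution.local_resolution_of_An_stalk

end Summit.ResolutionOfSingularities.ResolutionOfSingularities.Cruxes.FRationalResolution.Lines.Sketch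

end
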